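import Literature.Analysis.FluidPDE.PeriodicLerayExistence
import Literature.Analysis.FluidPDE.NSCylinderVelocityCompactness
import Literature.Analysis.FluidPDE.SuitableWeakStability
import Literature.Analysis.FluidPDE.PeriodicLerayGradient
import Literature.Analysis.FluidPDE.PeriodicLerayTransportGradient
import Literature.Analysis.FluidPDE.MollifiedSliceTools
import Literature.Analysis.UnboundedOperators.HeatKernel
import HarnessLib

/-!
# [BT1] proof of Theorem 2.4, the limit `ε → 0`, I: strong `L²` compactness of the approximants
  on cylinders

Analysis/FluidPDE proof file (theorems only, no new definitions, no named facts), first part of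
the discharge of the named fact `Literature.Analysis.FluidPDE.bradshawTsai2017_thm_2_4_limit`
(`PeriodicLerayExistence.lean`; Bradshaw–Tsai, Ann. Henri Poincaré 18 (2017) = arXiv:1510.07504
[BT1], §2, proof of Thm 2.4, last part): "Because `U_ε` are bounded independently of `ε` in
`L^∞(0,T;L²(ℝ³)) ∩ L²(0,T;H¹₀(ℝ³))`, and `U_ε` is a weak solution of [the mollified perturbed
Leray equations] with `W` bounded by Lemma 2.5, there exists … `U` … and a sequence … so that …
`U_{ε_k} → U` strongly in `L²(0,T;L²(K))` for all compact sets `K ⊂ ℝ³`".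

This file supplies exactly that strong compactness, on every cylinder `(a, b) × B(x₀, R)`, for a
sequence `(U_k, p_k)` of `T`-periodic weak solutions of the mollified perturbed Leray systems
(`BradshawTsai2017.IsMollifiedPeriodicWeakSolution T W η ε_k C U_k p_k`) with a common bound
`C`: the Rellich–Lions / Aubin–Lions argument in the form of the tree's generic theorem
`AubinLions.exists_subseq_strong_limit_of_equicontinuous` (`FunctionSpaces/AubinLionsExtraction`:
Ehrling's lemma, Rellich–Kondrachov, equicontinuous pairings), whose only equation-specific input
is the **weak equicontinuity in time of the pairings** `s ↦ ∫_Ω ⟪U_k(s), ζ⟫`. That input is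
derived here from the distributional form of the mollified perturbed Leray system
(`IsMollifiedPeriodicWeakSolution.distributional`), tested with `χ(s) ζ(y)`, exactly as the
tree's `NSCylinderVelocityCompactness` does for the Navier–Stokes equations:

* `setIntegral_deriv_mul_pairing_add_eq_zero`, `exists_ae_pairing_eq_const_add_primitive` —
  `∫_Ω ⟪u(s), ζ⟫ = c + ∫_{(a,s]} f_ζ` for a.e. `s`, `u = U + W`, with the remainder
  `f_ζ = ∫_Ω (⟪u, Δζ⟫ − ⟪u, 2ζ + Dζ y⟫ + ⟪U, Dζ b⟫ + ⟪W, Dζ u⟫ + p div ζ)`, `b = W + η_ε * U`;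
* `ae_abs_remainder_le`, `exists_fullMeasure_pairing_modulus` — the modulus
  `|∫_Ω ⟪U(t), ζ⟫ − ∫_Ω ⟪U(s), ζ⟫| ≤ A |t − s| + B |t − s|^{1/3}` on a full-measure set of times,
  with `A`, `B` depending on the solution only through `C`, the kernel `η`, and bounds of `W`,
  `∂ₛW` on the closed cylinder (the pressure enters through its `L^{5/3}((0,T) × ℝ³)` bound,
  turned into an `L^{3/2}` bound on the cylinder by periodicity and Hölder);
* `exists_subseq_strong_limit_velocity` — **the compactness theorem** on `(a, b) × B(x₀, R)`.

## Design notes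

* The Aubin–Lions theorem is run on the perturbations `U_k` (uniform `L^∞L²`, `L²H¹` bounds are
  hypotheses of the structure), while the momentum equation is naturally tested in `u_k = U_k + W`;
  the pairing of the fixed `C¹` profile `W` is Lipschitz in time on compact cylinders (mean value
  theorem), which is all the transfer costs.
* Young's inequality for the mollified drift, `‖η_ε * U(s)‖_{L²} ≤ ‖η‖_{L¹} ‖U(s)‖_{L²}`, is
  the tree's `UnboundedOperators.eLpNorm_convolution_le_lintegral_enorm_mul`; `η` may be signed.

## References

* Z. Bradshaw, T.-P. Tsai, Ann. Henri Poincaré 18 (2017) 1095–1119 = arXiv:1510.07504, §2,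
  proof of Thm 2.4 (the limit `ε → 0`) [BradshawTsai2017AHP].
* R. Temam, *Navier–Stokes equations* (1977/79), Ch. III, §2 Thm. 2.1, §3 [Temam1979].
* P. G. Lemarié-Rieusset, *The Navier–Stokes problem in the 21st century* (2016), Thm. 12.1
  (Rellich–Lions) [Lemarierieusset2016].
-/

noncomputable section

open MeasureTheory TopologicalSpace Set Function Filter Metric Bornology intervalIntegral
open scoped NNReal ENNReal Topology InnerProductSpace RealInnerProductSpace Laplacian Convolution

namespace Literature.Analysis.FluidPDE

namespace BradshawTsai2017

/-! ### Basic classes of the approximants -/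

section Basic

variable {T : ℝ} {W : ℝ → (EuclideanSpace ℝ (Fin 3)) → (EuclideanSpace ℝ (Fin 3))} {η : (EuclideanSpace ℝ (Fin 3)) → ℝ} {ε : ℝ} {C : ℝ≥0} {U : ℝ → (EuclideanSpace ℝ (Fin 3)) → (EuclideanSpace ℝ (Fin 3))}
  {p : ℝ → (EuclideanSpace ℝ (Fin 3)) → ℝ}

/-- The velocity of a periodic weak solution of the mollified system is jointly (a.e. strongly)
measurable on space–time (it is locally integrable, being weakly differentiable in space). [folklore] -/
theorem IsMollifiedPeriodicWeakSolution.aestronglyMeasurable_velocity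
    (h : IsMollifiedPeriodicWeakSolution T W η ε C U p) :
    AEStronglyMeasurable (uncurry U) (volume : Measure (ℝ × (EuclideanSpace ℝ (Fin 3)))) := by
  obtain ⟨G, hG, -⟩ := h.weakForm
  have h1 := hG.locallyIntegrableOn.aestronglyMeasurable
  rwa [Opens.coe_top, Measure.restrict_univ] at h1

/-- The velocity of a periodic weak solution of the mollified system is locally integrable on
space–time. [folklore] -/
theorem IsMollifiedPeriodicWeakSolution.locallyIntegrable_velocity
    (h : IsMollifiedPeriodicWeakSolution T W η ε C U p) :
    LocallyIntegrable (uncurry U) (volume : Measure (ℝ × (EuclideanSpace ℝ (Fin 3)))) := by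
  obtain ⟨G, hG, -⟩ := h.weakForm
  have h1 := hG.locallyIntegrableOn
  rwa [Opens.coe_top, locallyIntegrableOn_univ] at h1

/-- The pressure of a periodic weak solution of the mollified system is jointly (a.e. strongly)
measurable on space–time. [folklore] -/
theorem IsMollifiedPeriodicWeakSolution.aestronglyMeasurable_pressure
    (h : IsMollifiedPeriodicWeakSolution T W η ε C U p) :
    AEStronglyMeasurable (uncurry p) (volume : Measure (ℝ × (EuclideanSpace ℝ (Fin 3)))) :=
  h.locallyIntegrable_pressure.aestronglyMeasurable

/-- Almost every time slice of the velocity is (a.e. strongly) measurable. [folklore] -/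
theorem IsMollifiedPeriodicWeakSolution.ae_aestronglyMeasurable_slice
    (h : IsMollifiedPeriodicWeakSolution T W η ε C U p) :
    ∀ᵐ s : ℝ, AEStronglyMeasurable (U s) (volume : Measure (EuclideanSpace ℝ (Fin 3))) := by
  have h1 := h.aestronglyMeasurable_velocity
  rw [Measure.volume_eq_prod] at h1
  exact h1.prodMk_left

/-- Almost every time slice of the velocity is in `L²(ℝ³)` with `‖U(s)‖²_{L²} ≤ C`. [folklore] -/
theorem IsMollifiedPeriodicWeakSolution.ae_memLp_two_slice
    (h : IsMollifiedPeriodicWeakSolution T W η ε C U p) :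
    ∀ᵐ s : ℝ, MemLp (U s) 2 (volume : Measure (EuclideanSpace ℝ (Fin 3))) ∧
      eLpNorm (U s) 2 (volume : Measure (EuclideanSpace ℝ (Fin 3))) ≤ (C : ℝ≥0∞) ^ (1 / 2 : ℝ) := by
  filter_upwards [h.ae_aestronglyMeasurable_slice] with s hs
  have hle : eLpNorm (U s) 2 (volume : Measure (EuclideanSpace ℝ (Fin 3))) ≤ (C : ℝ≥0∞) ^ (1 / 2 : ℝ) := by
    rw [FunctionSpaces.AubinLions.eLpNorm_two_eq_rpow]
    exact ENNReal.rpow_le_rpow (h.energy_le s) (by norm_num)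
  exact ⟨⟨hs, hle.trans_lt (ENNReal.rpow_lt_top_of_nonneg (by norm_num) ENNReal.coe_ne_top)⟩,
    hle⟩

end Basic

/-! ### The mollifying kernels: `L¹` norm and Young's inequality -/

section Kernel

variable {η : (EuclideanSpace ℝ (Fin 3)) → ℝ}

/-- A mollifying kernel is integrable. [folklore] -/
theorem IsMollifyingKernel.integrable (hη : IsMollifyingKernel η) :
    Integrable η (volume : Measure (EuclideanSpace ℝ (Fin 3))) :=
  hη.contDiff.continuous.integrable_of_hasCompactSupport hη.hasCompactSupport

/-- The scaled kernels `η_ε` are continuous. [folklore] -/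
theorem IsMollifyingKernel.continuous_scaledMollifier (hη : IsMollifyingKernel η) (ε : ℝ) :
    Continuous (BradshawTsai2019.scaledMollifier η ε) :=
  BradshawTsai2019.continuous_scaledMollifier hη.contDiff.continuous ε

/-- The scaled kernels `η_ε` are integrable (`ε > 0`). [folklore] -/
theorem IsMollifyingKernel.integrable_scaledMollifier (hη : IsMollifyingKernel η) {ε : ℝ}
    (hε : 0 < ε) : Integrable (BradshawTsai2019.scaledMollifier η ε) (volume : Measure (EuclideanSpace ℝ (Fin 3))) := by
  obtain ⟨ρ, hρ⟩ := hη.hasCompactSupport.isCompact.isBounded.subset_closedBall (0 : (EuclideanSpace ℝ (Fin 3)))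
  have hη0 : ∀ y : (EuclideanSpace ℝ (Fin 3)), ρ + 1 ≤ ‖y‖ → η y = 0 := fun y hy =>
    image_eq_zero_of_notMem_tsupport fun h' => by
      have := mem_closedBall_zero_iff.1 (hρ h'); linarith
  exact (hη.continuous_scaledMollifier ε).integrable_of_hasCompactSupport
    (BradshawTsai2019.hasCompactSupport_scaledMollifier hη0 hε)

/-- **The `L¹` norm of the scaled kernels is that of `η`**: `∫ ‖η_ε‖ = ∫ ‖η‖` (`ε > 0`;
change of variables `y = εz`). [folklore] -/
theorem IsMollifyingKernel.lintegral_enorm_scaledMollifier (hη : IsMollifyingKernel η) {ε : ℝ}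
    (hε : 0 < ε) :
    ∫⁻ y, ‖BradshawTsai2019.scaledMollifier η ε y‖ₑ = ∫⁻ y, ‖η y‖ₑ := by
  have habs : ∀ y, ‖BradshawTsai2019.scaledMollifier η ε y‖ =
      BradshawTsai2019.scaledMollifier (fun z => ‖η z‖) ε y := fun y => by
    simp only [BradshawTsai2019.scaledMollifier_apply, norm_mul, norm_inv, norm_pow,
      Real.norm_eq_abs, abs_of_pos hε]
  have hint : Integrable (BradshawTsai2019.scaledMollifier (fun z => ‖η z‖) ε)
      (volume : Measure (EuclideanSpace ℝ (Fin 3))) := by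
    have h1 := (hη.integrable_scaledMollifier hε).norm
    exact h1.congr (Eventually.of_forall habs)
  have hnn : ∀ y, 0 ≤ BradshawTsai2019.scaledMollifier (fun z => ‖η z‖) ε y := fun y => by
    rw [← habs]; exact norm_nonneg _
  rw [← ofReal_integral_norm_eq_lintegral_enorm (hη.integrable_scaledMollifier hε),
    ← ofReal_integral_norm_eq_lintegral_enorm hη.integrable]
  congr 1
  rw [integral_congr_ae (Eventually.of_forall habs),
    BradshawTsai2019.integral_scaledMollifier _ hε]

/-- The `L¹` norm of a mollifying kernel is finite. [folklore] -/
theorem IsMollifyingKernel.lintegral_enorm_lt_top (hη : IsMollifyingKernel η) :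
    ∫⁻ y, ‖η y‖ₑ < ∞ :=
  hη.integrable.2

/-- **Young's inequality for the mollified drift**: `‖η_ε * f‖_{L²} ≤ ‖η‖_{L¹} ‖f‖_{L²}` for a
measurable field `f` (`ε > 0`; the kernel may be signed). [folklore] -/
theorem IsMollifyingKernel.eLpNorm_scaledMollifier_convolution_le (hη : IsMollifyingKernel η)
    {ε : ℝ} (hε : 0 < ε) {f : (EuclideanSpace ℝ (Fin 3)) → (EuclideanSpace ℝ (Fin 3))} (hf : AEStronglyMeasurable f (volume : Measure (EuclideanSpace ℝ (Fin 3))))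
    {q : ℝ≥0∞} (hq : 1 ≤ q) :
    eLpNorm (BradshawTsai2019.scaledMollifier η ε ⋆[ContinuousLinearMap.lsmul ℝ ℝ, volume] f) q
        volume ≤ (∫⁻ y, ‖η y‖ₑ) * eLpNorm f q volume := by
  have h := UnboundedOperators.eLpNorm_convolution_le_lintegral_enorm_mul (μ := volume)
    (hη.continuous_scaledMollifier ε).aestronglyMeasurable hf hq
  rwa [hη.lintegral_enorm_scaledMollifier hε] at h

/-- **The mollified velocity is jointly measurable** on space–time (a parametric integral of a
jointly measurable integrand; `MollifiedSliceTools.stronglyMeasurable_uncurry_convolution_lsmul`).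
[folklore] -/
theorem IsMollifyingKernel.aestronglyMeasurable_mollify (hη : IsMollifyingKernel η) (ε : ℝ)
    {U : ℝ → (EuclideanSpace ℝ (Fin 3)) → (EuclideanSpace ℝ (Fin 3))} (hU : AEStronglyMeasurable (uncurry U) (volume : Measure (ℝ × (EuclideanSpace ℝ (Fin 3))))) :
    AEStronglyMeasurable (uncurry (mollify η ε U)) (volume : Measure (ℝ × (EuclideanSpace ℝ (Fin 3)))) := by
  -- replace `U` by a strongly measurable representative; the convolutions agree everywhere in
  -- `y` for a.e. `s`, hence a.e. on the product
  have hU' : uncurry U =ᵐ[volume] hU.mk (uncurry U) := hU.ae_eq_mk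
  set V : ℝ → (EuclideanSpace ℝ (Fin 3)) → (EuclideanSpace ℝ (Fin 3)) := fun s y => hU.mk (uncurry U) (s, y) with hV
  have hVm : StronglyMeasurable (uncurry V) := hU.stronglyMeasurable_mk
  have hmV : StronglyMeasurable (uncurry (mollify η ε V)) :=
    stronglyMeasurable_uncurry_convolution_lsmul (hη.continuous_scaledMollifier ε) hVm
  refine ⟨uncurry (mollify η ε V), hmV, ?_⟩
  -- a.e. in `s`, the slices `U s` and `V s` agree a.e. in `y`
  have h1 : ∀ᵐ s : ℝ, U s =ᵐ[volume] V s := by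
    have h2 : ∀ᵐ z : ℝ × (EuclideanSpace ℝ (Fin 3)) ∂(volume : Measure ℝ).prod volume, uncurry U z = uncurry V z := by
      rw [← Measure.volume_eq_prod]; exact hU'
    filter_upwards [Measure.ae_ae_of_ae_prod h2] with s hs
    filter_upwards [hs] with y hy
    exact hy
  have h3 : ∀ᵐ s : ℝ, ∀ y, mollify η ε U s y = mollify η ε V s y := by
    filter_upwards [h1] with s hs
    intro y
    exact convolution_lsmul_congr_ae_right _ hs y
  have h4 : ∀ᵐ z : ℝ × (EuclideanSpace ℝ (Fin 3)) ∂((volume : Measure ℝ).prod (volume : Measure (EuclideanSpace ℝ (Fin 3)))),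
      ∀ y, mollify η ε U z.1 y = mollify η ε V z.1 y :=
    Measure.quasiMeasurePreserving_fst.ae h3
  rw [Measure.volume_eq_prod]
  filter_upwards [h4] with z hz
  exact hz z.2

end Kernel

end BradshawTsai2017

/-! ### Lower integrals of a.e. time-periodic densities over long windows, with constants -/

section Periodic

variable {E : Type*} [NormedAddCommGroup E] [InnerProductSpace ℝ E] [FiniteDimensional ℝ E]
  [MeasurableSpace E] [BorelSpace E]

/-- **Window bound over `m` periods for a.e. shift-invariant nonnegative fields**:
`∫⁻_{(a, a+mT] × E} f ≤ 2m ∫⁻_{(0,T) × E} f` when `f(s + kT, y) = f(s, y)` a.e. for every `k ∈ ℤ`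
(`T > 0`; the quantitative form of `setLIntegral_Ioc_prod_lt_top_of_ae_periodic`). [folklore] -/
theorem setLIntegral_Ioc_prod_le_of_ae_periodic {f : ℝ × E → ℝ≥0∞} {T : ℝ} (hT : 0 < T)
    (hf : ∀ k : ℤ, (fun z : ℝ × E => f (z.1 + k * T, z.2)) =ᵐ[volume] f) (a : ℝ) (m : ℕ) :
    ∫⁻ z in Ioc a (a + m * T) ×ˢ (univ : Set E), f z ≤
      2 * m * ∫⁻ z in Ioo 0 T ×ˢ (univ : Set E), f z := by
  induction m with
  | zero => simp
  | succ m ih =>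
    have hsplit : Ioc a (a + (m + 1 : ℕ) * T) ×ˢ (univ : Set E) ⊆
        (Ioc a (a + m * T) ×ˢ (univ : Set E)) ∪
          (Ioc (a + m * T) (a + m * T + T) ×ˢ (univ : Set E)) := by
      rintro ⟨s, y⟩ ⟨⟨hs1, hs2⟩, -⟩
      by_cases hs : s ≤ a + m * T
      · exact Or.inl ⟨⟨hs1, hs⟩, mem_univ _⟩
      · refine Or.inr ⟨⟨lt_of_not_ge hs, ?_⟩, mem_univ _⟩
        push_cast at hs2; linarith
    calc ∫⁻ z in Ioc a (a + ((m + 1 : ℕ) : ℝ) * T) ×ˢ (univ : Set E), f z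
        ≤ ∫⁻ z in (Ioc a (a + m * T) ×ˢ (univ : Set E)) ∪
            (Ioc (a + m * T) (a + m * T + T) ×ˢ (univ : Set E)), f z := lintegral_mono_set hsplit
      _ ≤ (∫⁻ z in Ioc a (a + m * T) ×ˢ (univ : Set E), f z) +
            ∫⁻ z in Ioc (a + m * T) (a + m * T + T) ×ˢ (univ : Set E), f z :=
          lintegral_union_le _ _ _
      _ ≤ 2 * m * (∫⁻ z in Ioo 0 T ×ˢ (univ : Set E), f z) +
            2 * ∫⁻ z in Ioo 0 T ×ˢ (univ : Set E), f z :=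
          add_le_add ih (setLIntegral_Ioc_prod_le_two_mul_of_ae_periodic hT hf _)
      _ = 2 * ((m + 1 : ℕ) : ℝ≥0∞) * ∫⁻ z in Ioo 0 T ×ˢ (univ : Set E), f z := by
          push_cast; ring

/-- **Window bound over a bounded time interval**:
`∫⁻_{(a,b) × E} f ≤ 2(⌈(b−a)/T⌉₊ + 1) ∫⁻_{(0,T) × E} f` for a.e. shift-invariant nonnegative `f`
(`T > 0`). [folklore] -/
theorem setLIntegral_Ioo_prod_le_of_ae_periodic {f : ℝ × E → ℝ≥0∞} {T : ℝ} (hT : 0 < T)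
    (hf : ∀ k : ℤ, (fun z : ℝ × E => f (z.1 + k * T, z.2)) =ᵐ[volume] f) (a b : ℝ) :
    ∫⁻ z in Ioo a b ×ˢ (univ : Set E), f z ≤
      2 * (⌈(b - a) / T⌉₊ + 1 : ℕ) * ∫⁻ z in Ioo 0 T ×ˢ (univ : Set E), f z := by
  set m : ℕ := ⌈(b - a) / T⌉₊ + 1 with hm
  have hbm : b ≤ a + m * T := by
    have h1 : (b - a) / T ≤ ⌈(b - a) / T⌉₊ := Nat.le_ceil _
    have h2 : (⌈(b - a) / T⌉₊ : ℝ) < m := by rw [hm]; push_cast; linarith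
    have h3 : (b - a) / T < m := h1.trans_lt h2
    rw [div_lt_iff₀ hT] at h3
    linarith
  calc ∫⁻ z in Ioo a b ×ˢ (univ : Set E), f z
      ≤ ∫⁻ z in Ioc a (a + m * T) ×ˢ (univ : Set E), f z :=
        lintegral_mono_set (prod_mono (Ioo_subset_Ioc_self.trans (Ioc_subset_Ioc_right hbm))
          Subset.rfl)
    _ ≤ 2 * m * ∫⁻ z in Ioo 0 T ×ˢ (univ : Set E), f z :=
        setLIntegral_Ioc_prod_le_of_ae_periodic hT hf a m

/-- The window bound for (everywhere) time-periodic nonnegative fields. [folklore] -/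
theorem setLIntegral_Ioo_prod_le_of_periodic {f : ℝ × E → ℝ≥0∞} {T : ℝ} (hT : 0 < T)
    (hf : ∀ s y, f (s + T, y) = f (s, y)) (a b : ℝ) :
    ∫⁻ z in Ioo a b ×ˢ (univ : Set E), f z ≤
      2 * (⌈(b - a) / T⌉₊ + 1 : ℕ) * ∫⁻ z in Ioo 0 T ×ˢ (univ : Set E), f z := by
  refine setLIntegral_Ioo_prod_le_of_ae_periodic hT (fun k => Eventually.of_forall fun z => ?_) a b
  have hp : Function.Periodic (fun s => f (s, z.2)) T := fun s => hf s z.2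
  exact hp.int_mul k z.1

end Periodic

namespace BradshawTsai2017

/-! ### The fixed profile on compact cylinders -/

section Profile

variable {W : ℝ → (EuclideanSpace ℝ (Fin 3)) → (EuclideanSpace ℝ (Fin 3))}

/-- **A `C¹` profile and its derivative are bounded on compact cylinders**
`[a, b] × B̄(x₀, R)`. [folklore] -/
theorem exists_profile_bound (hW : ContDiff ℝ 1 (uncurry W)) (a b : ℝ) (x₀ : (EuclideanSpace ℝ (Fin 3))) (R : ℝ) :
    ∃ M : ℝ, 0 ≤ M ∧ (∀ s ∈ Icc a b, ∀ y ∈ closedBall x₀ R, ‖W s y‖ ≤ M) ∧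
      ∀ s ∈ Icc a b, ∀ y ∈ closedBall x₀ R, ‖fderiv ℝ (uncurry W) (s, y)‖ ≤ M := by
  have hK : IsCompact (Icc a b ×ˢ closedBall x₀ R) :=
    isCompact_Icc.prod (isCompact_closedBall x₀ R)
  obtain ⟨M₁, hM₁⟩ := hK.exists_bound_of_continuousOn hW.continuous.continuousOn
  obtain ⟨M₂, hM₂⟩ := hK.exists_bound_of_continuousOn
    (hW.continuous_fderiv one_ne_zero).continuousOn
  refine ⟨max (max M₁ M₂) 0, le_max_right _ _, fun s hs y hy => ?_, fun s hs y hy => ?_⟩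
  · exact (hM₁ (s, y) ⟨hs, hy⟩).trans ((le_max_left _ _).trans (le_max_left _ _))
  · exact (hM₂ (s, y) ⟨hs, hy⟩).trans ((le_max_right _ _).trans (le_max_left _ _))

/-- Each time line `s ↦ W(s, y)` of a `C¹` profile is differentiable with derivative
`D(uncurry W)(s, y)(1, 0)`. [folklore] -/
theorem hasDerivAt_profile_time (hW : ContDiff ℝ 1 (uncurry W)) (s : ℝ) (y : (EuclideanSpace ℝ (Fin 3))) :
    HasDerivAt (fun s => W s y) (fderiv ℝ (uncurry W) (s, y) ((1 : ℝ), (0 : (EuclideanSpace ℝ (Fin 3))))) s := by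
  have hd : HasFDerivAt (uncurry W) (fderiv ℝ (uncurry W) (s, y)) (s, y) :=
    (hW.differentiable one_ne_zero (s, y)).hasFDerivAt
  have hl : HasDerivAt (fun s : ℝ => ((s, y) : ℝ × (EuclideanSpace ℝ (Fin 3)))) ((1 : ℝ), (0 : (EuclideanSpace ℝ (Fin 3)))) s :=
    (hasDerivAt_id s).prodMk (hasDerivAt_const s y)
  exact hd.comp_hasDerivAt s hl

/-- **The pairing of a `C¹` profile with a bounded field is Lipschitz in time on compact
cylinders**: with `‖D(uncurry W)‖ ≤ M` on `[a, b] × B̄(x₀, R)` and `‖ζ‖ ≤ K₀`,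
`|∫_{B(x₀,R)} ⟪W(t), ζ⟫ − ∫_{B(x₀,R)} ⟪W(s), ζ⟫| ≤ M K₀ |B(x₀,R)| |t − s|` for `s, t ∈ [a, b]` (mean
value theorem along the time lines). [folklore] -/
theorem abs_setIntegral_inner_profile_sub_le (hW : ContDiff ℝ 1 (uncurry W)) {a b : ℝ}
    {x₀ : (EuclideanSpace ℝ (Fin 3))} {R M : ℝ}
    (hM : ∀ s ∈ Icc a b, ∀ y ∈ closedBall x₀ R, ‖fderiv ℝ (uncurry W) (s, y)‖ ≤ M)
    {ζ : (EuclideanSpace ℝ (Fin 3)) → (EuclideanSpace ℝ (Fin 3))} (hζ : Continuous ζ) {K₀ : ℝ} (hK₀ : ∀ y, ‖ζ y‖ ≤ K₀)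
    {s t : ℝ} (hs : s ∈ Icc a b) (ht : t ∈ Icc a b) :
    |(∫ y in ball x₀ R, ⟪W t y, ζ y⟫) - ∫ y in ball x₀ R, ⟪W s y, ζ y⟫| ≤
      M * K₀ * (volume (ball x₀ R)).toReal * |t - s| := by
  have hK₀0 : 0 ≤ K₀ := (norm_nonneg _).trans (hK₀ 0)
  have hWr : ∀ r, Continuous (W r) := fun r =>
    hW.continuous.comp (continuous_const.prodMk continuous_id)
  -- the Lipschitz bound along the time lines through the ball
  have hlip : ∀ y ∈ ball x₀ R, ‖W t y - W s y‖ ≤ M * |t - s| := by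
    intro y hy
    have hy' : y ∈ closedBall x₀ R := ball_subset_closedBall hy
    have h := (convex_Icc a b).norm_image_sub_le_of_norm_hasDerivWithin_le (C := M)
      (f := fun r => W r y) (f' := fun r => fderiv ℝ (uncurry W) (r, y) ((1 : ℝ), (0 : (EuclideanSpace ℝ (Fin 3)))))
      (fun r _ => (hasDerivAt_profile_time hW r y).hasDerivWithinAt) (fun r hr => ?_) hs ht
    · simpa only [Real.norm_eq_abs] using h
    · calc ‖fderiv ℝ (uncurry W) (r, y) ((1 : ℝ), (0 : (EuclideanSpace ℝ (Fin 3))))‖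
          ≤ ‖fderiv ℝ (uncurry W) (r, y)‖ * ‖((1 : ℝ), (0 : (EuclideanSpace ℝ (Fin 3))))‖ :=
            ContinuousLinearMap.le_opNorm _ _
        _ ≤ M * 1 := by
            refine mul_le_mul (hM r hr y hy') ?_ (norm_nonneg _)
              ((norm_nonneg _).trans (hM r hr y hy'))
            simp [Prod.norm_def]
        _ = M := mul_one M
  -- integrability of the pairings on the ball (continuous on the closed ball)
  have hint : ∀ r, IntegrableOn (fun y => ⟪W r y, ζ y⟫) (ball x₀ R) volume := fun r =>
    ((((hWr r).inner hζ).continuousOn).integrableOn_compact (μ := (volume : Measure (EuclideanSpace ℝ (Fin 3))))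
      (isCompact_closedBall x₀ R)).mono_set ball_subset_closedBall
  rw [← integral_sub (hint t) (hint s)]
  have hbd : ∀ y ∈ ball x₀ R, ‖⟪W t y, ζ y⟫ - ⟪W s y, ζ y⟫‖ ≤ M * |t - s| * K₀ := by
    intro y hy
    rw [← inner_sub_left]
    exact (norm_inner_le_norm _ _).trans (mul_le_mul (hlip y hy) (hK₀ y) (norm_nonneg _)
      ((norm_nonneg _).trans (hlip y hy)))
  have h := norm_setIntegral_le_of_norm_le_const
    (measure_ball_lt_top (μ := (volume : Measure (EuclideanSpace ℝ (Fin 3)))) (x := x₀) (r := R)) hbd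
  rw [Real.norm_eq_abs] at h
  calc |∫ y in ball x₀ R, (⟪W t y, ζ y⟫ - ⟪W s y, ζ y⟫)|
      ≤ M * |t - s| * K₀ * (volume (ball x₀ R)).toReal := by
        simpa only [measureReal_def] using h
    _ = M * K₀ * (volume (ball x₀ R)).toReal * |t - s| := by ring

end Profile

/-! ### Classes of the approximants on a cylinder `(a, b) × B(x₀, R)` -/

section Cylinder

variable {T : ℝ} {W : ℝ → (EuclideanSpace ℝ (Fin 3)) → (EuclideanSpace ℝ (Fin 3))} {η : (EuclideanSpace ℝ (Fin 3)) → ℝ} {ε : ℝ} {C : ℝ≥0} {U : ℝ → (EuclideanSpace ℝ (Fin 3)) → (EuclideanSpace ℝ (Fin 3))}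
  {p : ℝ → (EuclideanSpace ℝ (Fin 3)) → ℝ} {a b : ℝ} {x₀ : (EuclideanSpace ℝ (Fin 3))} {R : ℝ}

/-- `(10, 10/9)` are Hölder conjugate. [folklore] -/
theorem holderConjugate_ten : (10 : ℝ).HolderConjugate (10 / 9) :=
  Real.holderConjugate_iff.2 ⟨by norm_num, by norm_num⟩

/-- **From `L^{5/3}` to `L^{3/2}` on a finite measure space** (Hölder against `1` with exponents
`(10, 10/9)`): `∫⁻ f^{3/2} ≤ μ(univ)^{1/10} (∫⁻ f^{5/3})^{9/10}`. [folklore] -/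
theorem lintegral_rpow_threeHalves_le_of_fiveThirds {α : Type*} [MeasurableSpace α]
    (μ : Measure α) {f : α → ℝ≥0∞} (hf : AEMeasurable f μ) :
    ∫⁻ x, f x ^ (3 / 2 : ℝ) ∂μ ≤
      μ univ ^ (1 / 10 : ℝ) * (∫⁻ x, f x ^ (5 / 3 : ℝ) ∂μ) ^ (9 / 10 : ℝ) := by
  have h := ENNReal.lintegral_mul_le_Lp_mul_Lq μ holderConjugate_ten aemeasurable_const
    (hf.pow_const (3 / 2 : ℝ)) (f := fun _ => 1)
  simp only [Pi.mul_apply, one_mul, ENNReal.one_rpow, lintegral_const, one_div] at h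
  have e : ∀ x, (f x ^ (3 / 2 : ℝ)) ^ (10 / 9 : ℝ) = f x ^ (5 / 3 : ℝ) := fun x => by
    rw [← ENNReal.rpow_mul]; norm_num
  simp only [e] at h
  have e2 : (10 / 9 : ℝ)⁻¹ = 9 / 10 := by norm_num
  have e3 : (10 : ℝ)⁻¹ = 1 / 10 := by norm_num
  rw [e2, e3] at h
  exact h

/-- **The velocity on the cylinder is in `L²`**: `∫∫_{(a,b)×B(x₀,R)} |U|² ≤ (b − a) C`. [folklore] -/
theorem IsMollifiedPeriodicWeakSolution.lintegral_cylinder_sq_le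
    (h : IsMollifiedPeriodicWeakSolution T W η ε C U p) (a b : ℝ) (x₀ : (EuclideanSpace ℝ (Fin 3))) (R : ℝ) :
    ∫⁻ z in Ioo a b ×ˢ ball x₀ R, ‖U z.1 z.2‖ₑ ^ 2 ≤ ENNReal.ofReal (b - a) * C := by
  have hm : AEStronglyMeasurable (uncurry U) (volume.restrict (Ioo a b ×ˢ ball x₀ R)) :=
    h.aestronglyMeasurable_velocity.restrict
  change ∫⁻ z in Ioo a b ×ˢ ball x₀ R, ‖uncurry U z‖ₑ ^ 2 ≤ _
  rw [FunctionSpaces.AubinLions.lintegral_sq_eq_lintegral_slice hm]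
  calc ∫⁻ t in Ioo a b, ∫⁻ x in ball x₀ R, ‖uncurry U (t, x)‖ₑ ^ 2
      ≤ ∫⁻ _ in Ioo a b, (C : ℝ≥0∞) := by
        refine lintegral_mono fun t => ?_
        exact (setLIntegral_le_lintegral _ _).trans (h.energy_le t)
    _ = ENNReal.ofReal (b - a) * C := by
        rw [lintegral_const, Measure.restrict_apply_univ, Real.volume_Ioo, mul_comm]

/-- The slice energies on the ball are bounded by `C`, for a.e. (indeed every) time. [folklore] -/
theorem IsMollifiedPeriodicWeakSolution.ae_lintegral_ball_sq_le
    (h : IsMollifiedPeriodicWeakSolution T W η ε C U p) (a b : ℝ) (x₀ : (EuclideanSpace ℝ (Fin 3))) (R : ℝ) :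
    ∀ᵐ t ∂(volume.restrict (Ioo a b)), ∫⁻ x in ball x₀ R, ‖U t x‖ₑ ^ 2 ≤ C :=
  Eventually.of_forall fun t => (setLIntegral_le_lintegral _ _).trans (h.energy_le t)

/-- **Young for the slices of the mollified velocity**: for a.e. `s`,
`∫ |η_ε * U(s)|² ≤ ‖η‖²_{L¹} C`. [folklore] -/
theorem IsMollifiedPeriodicWeakSolution.ae_lintegral_mollify_sq_le
    (h : IsMollifiedPeriodicWeakSolution T W η ε C U p) (hη : IsMollifyingKernel η) (hε : 0 < ε) :
    ∀ᵐ s : ℝ, ∫⁻ y, ‖mollify η ε U s y‖ₑ ^ 2 ≤ (∫⁻ y, ‖η y‖ₑ) ^ 2 * C := by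
  filter_upwards [h.ae_memLp_two_slice] with s hs
  have h1 := hη.eLpNorm_scaledMollifier_convolution_le hε hs.1.1 one_le_two
  have h2 : eLpNorm (mollify η ε U s) 2 volume ≤ (∫⁻ y, ‖η y‖ₑ) * (C : ℝ≥0∞) ^ (1 / 2 : ℝ) :=
    h1.trans (mul_le_mul' le_rfl hs.2)
  calc ∫⁻ y, ‖mollify η ε U s y‖ₑ ^ 2 = eLpNorm (mollify η ε U s) 2 volume ^ 2 :=
        (FunctionSpaces.AubinLions.eLpNorm_two_sq _ _).symm
    _ ≤ ((∫⁻ y, ‖η y‖ₑ) * (C : ℝ≥0∞) ^ (1 / 2 : ℝ)) ^ 2 := pow_le_pow_left' h2 2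
    _ = (∫⁻ y, ‖η y‖ₑ) ^ 2 * C := by
        rw [mul_pow, ← ENNReal.rpow_natCast ((C : ℝ≥0∞) ^ (1 / 2 : ℝ)), ← ENNReal.rpow_mul]
        norm_num

/-- **The mollified velocity on the cylinder is in `L²`**:
`∫∫_{(a,b)×B(x₀,R)} |η_ε * U|² ≤ (b − a) ‖η‖²_{L¹} C`. [folklore] -/
theorem IsMollifiedPeriodicWeakSolution.lintegral_cylinder_mollify_sq_le
    (h : IsMollifiedPeriodicWeakSolution T W η ε C U p) (hη : IsMollifyingKernel η) (hε : 0 < ε)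
    (a b : ℝ) (x₀ : (EuclideanSpace ℝ (Fin 3))) (R : ℝ) :
    ∫⁻ z in Ioo a b ×ˢ ball x₀ R, ‖mollify η ε U z.1 z.2‖ₑ ^ 2 ≤
      ENNReal.ofReal (b - a) * ((∫⁻ y, ‖η y‖ₑ) ^ 2 * C) := by
  have hm : AEStronglyMeasurable (uncurry (mollify η ε U))
      (volume.restrict (Ioo a b ×ˢ ball x₀ R)) :=
    (hη.aestronglyMeasurable_mollify ε h.aestronglyMeasurable_velocity).restrict
  change ∫⁻ z in Ioo a b ×ˢ ball x₀ R, ‖uncurry (mollify η ε U) z‖ₑ ^ 2 ≤ _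
  rw [FunctionSpaces.AubinLions.lintegral_sq_eq_lintegral_slice hm]
  calc ∫⁻ t in Ioo a b, ∫⁻ x in ball x₀ R, ‖uncurry (mollify η ε U) (t, x)‖ₑ ^ 2
      ≤ ∫⁻ _ in Ioo a b, (∫⁻ y, ‖η y‖ₑ) ^ 2 * (C : ℝ≥0∞) := by
        refine lintegral_mono_ae (ae_restrict_of_ae ?_)
        filter_upwards [h.ae_lintegral_mollify_sq_le hη hε] with t ht
        exact (setLIntegral_le_lintegral _ _).trans ht
    _ = ENNReal.ofReal (b - a) * ((∫⁻ y, ‖η y‖ₑ) ^ 2 * C) := by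
        rw [lintegral_const, Measure.restrict_apply_univ, Real.volume_Ioo, mul_comm]

/-- **The pressure over a bounded time window**: by periodicity,
`∫∫_{(a,b)×ℝ³} |p|^{5/3} ≤ 2(⌈(b−a)/T⌉₊ + 1) C`. [folklore] -/
theorem IsMollifiedPeriodicWeakSolution.lintegral_window_pressure_le
    (h : IsMollifiedPeriodicWeakSolution T W η ε C U p) (hT : 0 < T) (a b : ℝ) :
    ∫⁻ z in Ioo a b ×ˢ (univ : Set (EuclideanSpace ℝ (Fin 3))), ‖p z.1 z.2‖ₑ ^ (5 / 3 : ℝ) ≤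
      2 * (⌈(b - a) / T⌉₊ + 1 : ℕ) * C :=
  (setLIntegral_Ioo_prod_le_of_periodic (f := fun z : ℝ × (EuclideanSpace ℝ (Fin 3)) => ‖p z.1 z.2‖ₑ ^ (5 / 3 : ℝ)) hT
    (fun s y => by simp only [h.periodic_pressure s y]) a b).trans
    (mul_le_mul' le_rfl h.pressure_le)

/-- **The pressure on the cylinder is in `L^{3/2}`**, with a bound depending only on `C`, `T` and
the cylinder: `∫∫_{(a,b)×B(x₀,R)} |p|^{3/2} ≤ |(a,b)×B(x₀,R)|^{1/10} (2(⌈(b−a)/T⌉₊+1) C)^{9/10}`.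
[folklore] -/
theorem IsMollifiedPeriodicWeakSolution.lintegral_cylinder_pressure_le
    (h : IsMollifiedPeriodicWeakSolution T W η ε C U p) (hT : 0 < T) (a b : ℝ) (x₀ : (EuclideanSpace ℝ (Fin 3)))
    (R : ℝ) :
    ∫⁻ z in Ioo a b ×ˢ ball x₀ R, ‖p z.1 z.2‖ₑ ^ (3 / 2 : ℝ) ≤
      volume (Ioo a b ×ˢ ball x₀ R) ^ (1 / 10 : ℝ) *
        (2 * (⌈(b - a) / T⌉₊ + 1 : ℕ) * (C : ℝ≥0∞)) ^ (9 / 10 : ℝ) := by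
  have hm : AEMeasurable (fun z : ℝ × (EuclideanSpace ℝ (Fin 3)) => ‖p z.1 z.2‖ₑ)
      (volume.restrict (Ioo a b ×ˢ ball x₀ R)) :=
    (h.aestronglyMeasurable_pressure.restrict).enorm
  refine (lintegral_rpow_threeHalves_le_of_fiveThirds _ hm).trans ?_
  rw [Measure.restrict_apply_univ]
  gcongr
  exact (lintegral_mono_set (prod_mono Subset.rfl (subset_univ _))).trans
    (h.lintegral_window_pressure_le hT a b)

/-- The `L^{3/2}` bound of the pressure on the cylinder is finite. [folklore] -/
theorem cylinderPressureBound_ne_top (T : ℝ) (C : ℝ≥0) (a b : ℝ) (x₀ : (EuclideanSpace ℝ (Fin 3))) (R : ℝ) :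
    volume (Ioo a b ×ˢ ball x₀ R) ^ (1 / 10 : ℝ) *
        (2 * (⌈(b - a) / T⌉₊ + 1 : ℕ) * (C : ℝ≥0∞)) ^ (9 / 10 : ℝ) ≠ ⊤ := by
  refine ENNReal.mul_ne_top (ENNReal.rpow_ne_top_of_nonneg (by norm_num) ?_)
    (ENNReal.rpow_ne_top_of_nonneg (by norm_num) ?_)
  · rw [Measure.volume_eq_prod, Measure.prod_prod]
    exact ENNReal.mul_ne_top measure_Ioo_lt_top.ne measure_ball_lt_top.ne
  · exact ENNReal.mul_ne_top (ENNReal.mul_ne_top ENNReal.ofNat_ne_top (ENNReal.natCast_ne_top _))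
      ENNReal.coe_ne_top

/-- **The pressure is integrable on the cylinder.** [folklore] -/
theorem IsMollifiedPeriodicWeakSolution.integrable_cylinder_pressure
    (h : IsMollifiedPeriodicWeakSolution T W η ε C U p) (hT : 0 < T) (a b : ℝ) (x₀ : (EuclideanSpace ℝ (Fin 3)))
    (R : ℝ) : Integrable (uncurry p) (volume.restrict (Ioo a b ×ˢ ball x₀ R)) :=
  NSCylinder.integrable_pressure_of_lintegral_rpow (Ω := ⟨ball x₀ R, isOpen_ball⟩) isBounded_ball
    h.aestronglyMeasurable_pressure.restrict
    ((h.lintegral_cylinder_pressure_le hT a b x₀ R).trans_lt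
      (cylinderPressureBound_ne_top T C a b x₀ R).lt_top)

/-- **The velocity is integrable and square integrable on the cylinder.** [folklore] -/
theorem IsMollifiedPeriodicWeakSolution.integrable_cylinder_velocity
    (h : IsMollifiedPeriodicWeakSolution T W η ε C U p) (a b : ℝ) (x₀ : (EuclideanSpace ℝ (Fin 3))) (R : ℝ) :
    Integrable (uncurry U) (volume.restrict (Ioo a b ×ˢ ball x₀ R)) ∧
    Integrable (fun z : ℝ × (EuclideanSpace ℝ (Fin 3)) => ‖U z.1 z.2‖ ^ 2) (volume.restrict (Ioo a b ×ˢ ball x₀ R)) := by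
  have hm : AEStronglyMeasurable (uncurry U) (volume.restrict (Ioo a b ×ˢ ball x₀ R)) :=
    h.aestronglyMeasurable_velocity.restrict
  have hfin : ∫⁻ z in Ioo a b ×ˢ ball x₀ R, ‖U z.1 z.2‖ₑ ^ 2 < ∞ :=
    (h.lintegral_cylinder_sq_le a b x₀ R).trans_lt
      (ENNReal.mul_lt_top ENNReal.ofReal_lt_top ENNReal.coe_lt_top)
  exact ⟨NSCylinder.integrable_of_lintegral_sq (Ω := ⟨ball x₀ R, isOpen_ball⟩) isBounded_ball hm
    hfin, NSCylinder.integrable_norm_sq_of_lintegral_sq (Ω := ⟨ball x₀ R, isOpen_ball⟩) hm hfin⟩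

/-- **The mollified velocity is integrable and square integrable on the cylinder.** [folklore] -/
theorem IsMollifiedPeriodicWeakSolution.integrable_cylinder_mollify
    (h : IsMollifiedPeriodicWeakSolution T W η ε C U p) (hη : IsMollifyingKernel η) (hε : 0 < ε)
    (a b : ℝ) (x₀ : (EuclideanSpace ℝ (Fin 3))) (R : ℝ) :
    Integrable (uncurry (mollify η ε U)) (volume.restrict (Ioo a b ×ˢ ball x₀ R)) ∧
    Integrable (fun z : ℝ × (EuclideanSpace ℝ (Fin 3)) => ‖mollify η ε U z.1 z.2‖ ^ 2)
      (volume.restrict (Ioo a b ×ˢ ball x₀ R)) := by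
  have hm : AEStronglyMeasurable (uncurry (mollify η ε U))
      (volume.restrict (Ioo a b ×ˢ ball x₀ R)) :=
    (hη.aestronglyMeasurable_mollify ε h.aestronglyMeasurable_velocity).restrict
  have hfin : ∫⁻ z in Ioo a b ×ˢ ball x₀ R, ‖mollify η ε U z.1 z.2‖ₑ ^ 2 < ∞ :=
    (h.lintegral_cylinder_mollify_sq_le hη hε a b x₀ R).trans_lt
      (ENNReal.mul_lt_top ENNReal.ofReal_lt_top (ENNReal.mul_lt_top
        (ENNReal.pow_lt_top hη.lintegral_enorm_lt_top) ENNReal.coe_lt_top))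
  exact ⟨NSCylinder.integrable_of_lintegral_sq (Ω := ⟨ball x₀ R, isOpen_ball⟩) isBounded_ball hm
    hfin, NSCylinder.integrable_norm_sq_of_lintegral_sq (Ω := ⟨ball x₀ R, isOpen_ball⟩) hm hfin⟩

/-- **A bounded continuous profile is integrable on the cylinder**, and so is `U + W` together
with its square. [folklore] -/
theorem IsMollifiedPeriodicWeakSolution.integrable_cylinder_velocity_add
    (h : IsMollifiedPeriodicWeakSolution T W η ε C U p) (hWc : Continuous (uncurry W)) {M : ℝ}
    (hM : ∀ s ∈ Icc a b, ∀ y ∈ closedBall x₀ R, ‖W s y‖ ≤ M) :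
    Integrable (uncurry W) (volume.restrict (Ioo a b ×ˢ ball x₀ R)) ∧
    Integrable (uncurry fun t x => U t x + W t x) (volume.restrict (Ioo a b ×ˢ ball x₀ R)) ∧
    Integrable (fun z : ℝ × (EuclideanSpace ℝ (Fin 3)) => ‖U z.1 z.2 + W z.1 z.2‖ ^ 2)
      (volume.restrict (Ioo a b ×ˢ ball x₀ R)) := by
  set S : Set (ℝ × (EuclideanSpace ℝ (Fin 3))) := Ioo a b ×ˢ ball x₀ R with hS
  have hSm : MeasurableSet S := measurableSet_Ioo.prod measurableSet_ball
  have hSfin : volume S ≠ ∞ := by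
    rw [hS, Measure.volume_eq_prod, Measure.prod_prod]
    exact ENNReal.mul_ne_top measure_Ioo_lt_top.ne measure_ball_lt_top.ne
  haveI : IsFiniteMeasure (volume.restrict S) :=
    ⟨by rw [Measure.restrict_apply_univ]; exact hSfin.lt_top⟩
  have hWm : AEStronglyMeasurable (uncurry W) (volume.restrict S) :=
    hWc.aestronglyMeasurable.restrict
  have hWbd : ∀ᵐ z ∂(volume.restrict S), ‖uncurry W z‖ ≤ M := by
    filter_upwards [ae_restrict_mem hSm] with z hz
    exact hM z.1 (Ioo_subset_Icc_self hz.1) z.2 (ball_subset_closedBall hz.2)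
  have hWi : Integrable (uncurry W) (volume.restrict S) :=
    Measure.integrableOn_of_bounded hSfin hWc.aestronglyMeasurable hWbd
  obtain ⟨hUi, hU2⟩ := h.integrable_cylinder_velocity a b x₀ R
  have hsum : Integrable (uncurry fun t x => U t x + W t x) (volume.restrict S) := hUi.add hWi
  refine ⟨hWi, hsum, ?_⟩
  -- the square: `‖U + W‖² ≤ 2‖U‖² + 2‖W‖² ≤ 2‖U‖² + 2M²`
  have hm2 : AEStronglyMeasurable (fun z : ℝ × (EuclideanSpace ℝ (Fin 3)) => ‖U z.1 z.2 + W z.1 z.2‖ ^ 2)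
      (volume.restrict S) := (hsum.1.norm.pow 2)
  refine ((hU2.const_mul 2).add (integrable_const (2 * M ^ 2))).mono' hm2 ?_
  filter_upwards [hWbd] with z hz
  rw [Real.norm_eq_abs, abs_of_nonneg (sq_nonneg _)]
  show ‖U z.1 z.2 + W z.1 z.2‖ ^ 2 ≤ 2 * ‖U z.1 z.2‖ ^ 2 + 2 * M ^ 2
  have h1 : ‖U z.1 z.2 + W z.1 z.2‖ ≤ ‖U z.1 z.2‖ + ‖W z.1 z.2‖ := norm_add_le _ _
  have h2 : ‖W z.1 z.2‖ ≤ M := hz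
  have h0' : 0 ≤ ‖W z.1 z.2‖ := norm_nonneg _
  have h3 : ‖U z.1 z.2 + W z.1 z.2‖ ^ 2 ≤ (‖U z.1 z.2‖ + ‖W z.1 z.2‖) ^ 2 :=
    pow_le_pow_left₀ (norm_nonneg _) h1 2
  have h4 : ‖W z.1 z.2‖ ^ 2 ≤ M ^ 2 := pow_le_pow_left₀ h0' h2 2
  nlinarith [sq_nonneg (‖U z.1 z.2‖ - ‖W z.1 z.2‖), h3, h4]

end Cylinder

/-! ### The remainder of the tested momentum equation: integrability and bound -/

section Remainder

variable {X : Type*} [MeasurableSpace X] {μ : Measure X}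

/-- `|div ζ| ≤ 3 ‖Dζ‖`. [folklore] -/
theorem norm_divergence_le_three_mul {ζ : (EuclideanSpace ℝ (Fin 3)) → (EuclideanSpace ℝ (Fin 3))} {K₁ : ℝ} (hK₁ : ∀ x, ‖fderiv ℝ ζ x‖ ≤ K₁)
    (x : (EuclideanSpace ℝ (Fin 3))) : ‖VectorCalculus.divergence ζ x‖ ≤ 3 * K₁ := by
  set bb := EuclideanSpace.basisFun (Fin 3) ℝ
  rw [divergence_eq_sum_inner_fderiv bb ζ x, Real.norm_eq_abs]
  calc |∑ i, ⟪bb i, fderiv ℝ ζ x (bb i)⟫|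
      ≤ ∑ i, |⟪bb i, fderiv ℝ ζ x (bb i)⟫| := Finset.abs_sum_le_sum_abs _ _
    _ ≤ ∑ _i : Fin 3, K₁ := Finset.sum_le_sum fun i _ => ?_
    _ = 3 * K₁ := by simp
  calc |⟪bb i, fderiv ℝ ζ x (bb i)⟫| ≤ ‖bb i‖ * ‖fderiv ℝ ζ x (bb i)‖ := abs_real_inner_le_norm _ _
    _ ≤ 1 * (‖fderiv ℝ ζ x‖ * 1) := by
        rw [bb.norm_eq_one i]
        gcongr
        simpa [bb.norm_eq_one i] using (fderiv ℝ ζ x).le_opNorm (bb i)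
    _ ≤ K₁ := by simpa using hK₁ x

/-- `‖Dζ(x) x‖` is bounded for a test field `ζ` on a ball: by `‖Dζ‖ (‖x₀‖ + |R|)`. [folklore] -/
theorem norm_fderiv_apply_self_le {ζ : (EuclideanSpace ℝ (Fin 3)) → (EuclideanSpace ℝ (Fin 3))} {x₀ : (EuclideanSpace ℝ (Fin 3))} {R : ℝ}
    (hζ : FunctionSpaces.IsTestFunctionOn (⟨ball x₀ R, isOpen_ball⟩ : Opens (EuclideanSpace ℝ (Fin 3))) ζ) {K₁ : ℝ}
    (hK₁ : ∀ x, ‖fderiv ℝ ζ x‖ ≤ K₁) (x : (EuclideanSpace ℝ (Fin 3))) :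
    ‖fderiv ℝ ζ x x‖ ≤ K₁ * (‖x₀‖ + |R|) := by
  have hK₁0 : 0 ≤ K₁ := (norm_nonneg _).trans (hK₁ 0)
  by_cases hx : x ∈ ball x₀ R
  · have hxn : ‖x‖ ≤ ‖x₀‖ + |R| := by
      have h1 : ‖x - x₀‖ < R := by rwa [mem_ball_iff_norm] at hx
      calc ‖x‖ = ‖x₀ + (x - x₀)‖ := by rw [add_sub_cancel]
        _ ≤ ‖x₀‖ + ‖x - x₀‖ := norm_add_le _ _
        _ ≤ ‖x₀‖ + |R| := by linarith [le_abs_self R]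
    exact ((fderiv ℝ ζ x).le_opNorm x).trans (mul_le_mul (hK₁ x) hxn (norm_nonneg _) hK₁0)
  · have hx' : x ∉ tsupport (fderiv ℝ ζ) := fun h' => hx (hζ.tsupport_subset (tsupport_fderiv_subset ℝ h'))
    rw [image_eq_zero_of_notMem_tsupport hx']
    simp only [_root_.zero_apply, norm_zero]
    positivity

/-- **Integrability and bound of the remainder of the tested mollified perturbed Leray equation**
on a finite measure space (a slice `B(x₀,R)`, or a cylinder). With `u = U + W`, a bounded field
`‖W‖ ≤ M` a.e., `U, m ∈ L²`, `q ∈ L¹`, and a `C²` field `ζ` with `‖ζ‖ ≤ K₀`, `‖Dζ‖ ≤ K₁`,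
`‖Δζ‖ ≤ K₂`, `‖Dζ(x)x‖ ≤ K₃` (evaluated along a measurable `π : X → ℝ³`), the remainder
`⟪u, Δζ⟫ − ⟪u, 2ζ + Dζ x⟫ + ⟪U, Dζ (W + m)⟫ + ⟪W, Dζ u⟫ + q div ζ` is integrable and its integral
is bounded by `(K₂ + 2K₀ + K₃ + K₁M) ∫‖u‖ + K₁ (M ∫‖U‖ + ∫(‖U‖² + ‖m‖²)) + 3K₁ ∫|q|`. [folklore] -/
theorem integrable_remainder_and_abs_integral_le [IsFiniteMeasure μ] {π : X → (EuclideanSpace ℝ (Fin 3))}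
    (hπ : Measurable π) {U Wf m : X → (EuclideanSpace ℝ (Fin 3))} {q : X → ℝ}
    (hU : MemLp U 2 μ) (hW : AEStronglyMeasurable Wf μ) {M : ℝ} (hM0 : 0 ≤ M)
    (hWM : ∀ᵐ z ∂μ, ‖Wf z‖ ≤ M) (hm : MemLp m 2 μ) (hq : Integrable q μ)
    {ζ : (EuclideanSpace ℝ (Fin 3)) → (EuclideanSpace ℝ (Fin 3))} (hζ2 : ContDiff ℝ 2 ζ) {K₀ K₁ K₂ K₃ : ℝ} (hK₀ : ∀ x, ‖ζ x‖ ≤ K₀)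
    (hK₁ : ∀ x, ‖fderiv ℝ ζ x‖ ≤ K₁) (hK₂ : ∀ x, ‖Δ ζ x‖ ≤ K₂)
    (hK₃ : ∀ x, ‖fderiv ℝ ζ x x‖ ≤ K₃) :
    Integrable (fun z => ⟪U z + Wf z, Δ ζ (π z)⟫ -
        ⟪U z + Wf z, (2 : ℝ) • ζ (π z) + fderiv ℝ ζ (π z) (π z)⟫ +
        ⟪U z, fderiv ℝ ζ (π z) (Wf z + m z)⟫ + ⟪Wf z, fderiv ℝ ζ (π z) (U z + Wf z)⟫ +
        q z * VectorCalculus.divergence ζ (π z)) μ ∧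
    |∫ z, (⟪U z + Wf z, Δ ζ (π z)⟫ -
        ⟪U z + Wf z, (2 : ℝ) • ζ (π z) + fderiv ℝ ζ (π z) (π z)⟫ +
        ⟪U z, fderiv ℝ ζ (π z) (Wf z + m z)⟫ + ⟪Wf z, fderiv ℝ ζ (π z) (U z + Wf z)⟫ +
        q z * VectorCalculus.divergence ζ (π z)) ∂μ| ≤
      (K₂ + 2 * K₀ + K₃ + K₁ * M) * (∫ z, ‖U z + Wf z‖ ∂μ) +
        K₁ * (M * (∫ z, ‖U z‖ ∂μ) + ∫ z, (‖U z‖ ^ 2 + ‖m z‖ ^ 2) ∂μ) +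
        3 * K₁ * ∫ z, |q z| ∂μ := by
  -- constants are nonnegative
  have hK₀0 : 0 ≤ K₀ := (norm_nonneg _).trans (hK₀ 0)
  have hK₁0 : 0 ≤ K₁ := (norm_nonneg _).trans (hK₁ 0)
  have hK₂0 : 0 ≤ K₂ := (norm_nonneg _).trans (hK₂ 0)
  have hK₃0 : 0 ≤ K₃ := (norm_nonneg _).trans (hK₃ 0)
  -- continuity of the weights
  have hζc : Continuous ζ := hζ2.continuous
  have cD : Continuous (fderiv ℝ ζ) := hζ2.continuous_fderiv two_ne_zero
  have cL : Continuous (Δ ζ) := continuous_laplacian hζ2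
  have cdiv : Continuous (VectorCalculus.divergence ζ) := continuous_divergence cD
  have happ : Continuous (uncurry fun (L : (EuclideanSpace ℝ (Fin 3)) →L[ℝ] (EuclideanSpace ℝ (Fin 3))) (v : (EuclideanSpace ℝ (Fin 3))) => L v) :=
    isBoundedBilinearMap_apply.continuous
  have hdivb : ∀ x, ‖VectorCalculus.divergence ζ x‖ ≤ 3 * K₁ := norm_divergence_le_three_mul hK₁
  -- measurability of the fields
  have hUm : AEStronglyMeasurable U μ := hU.1
  have hmm : AEStronglyMeasurable m μ := hm.1
  have hum : AEStronglyMeasurable (fun z => U z + Wf z) μ := hUm.add hW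
  have hDm : AEStronglyMeasurable (fun z => fderiv ℝ ζ (π z)) μ :=
    (cD.measurable.comp hπ).aestronglyMeasurable
  -- `W` is in every `L^p`; `u = U + W ∈ L²`
  have hWmem : MemLp Wf 2 μ :=
    (memLp_top_of_bound hW M hWM).mono_exponent le_top
  have hu : MemLp (fun z => U z + Wf z) 2 μ := hU.add hWmem
  have hu1 : Integrable (fun z => U z + Wf z) μ := hu.integrable one_le_two
  have hU1 : Integrable U μ := hU.integrable one_le_two
  have hU2 : Integrable (fun z => ‖U z‖ ^ 2) μ := (memLp_two_iff_integrable_sq_norm hUm).1 hU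
  have hm2 : Integrable (fun z => ‖m z‖ ^ 2) μ := (memLp_two_iff_integrable_sq_norm hmm).1 hm
  -- the five pieces: measurability, domination, integrability
  -- (1) `⟪u, Δζ⟫`
  have m1 : AEStronglyMeasurable (fun z => ⟪U z + Wf z, Δ ζ (π z)⟫) μ :=
    hum.inner (cL.measurable.comp hπ).aestronglyMeasurable
  have b1 : ∀ z, ‖⟪U z + Wf z, Δ ζ (π z)⟫‖ ≤ K₂ * ‖U z + Wf z‖ := fun z => by
    rw [mul_comm]
    exact (norm_inner_le_norm _ _).trans (mul_le_mul_of_nonneg_left (hK₂ _) (norm_nonneg _))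
  have i1 : Integrable (fun z => ⟪U z + Wf z, Δ ζ (π z)⟫) μ :=
    (hu1.norm.const_mul K₂).mono' m1 (Eventually.of_forall b1)
  -- (2) `⟪u, 2ζ + Dζ x⟫`
  have m2 : AEStronglyMeasurable
      (fun z => ⟪U z + Wf z, (2 : ℝ) • ζ (π z) + fderiv ℝ ζ (π z) (π z)⟫) μ := by
    refine hum.inner ?_
    have h1 : Measurable fun z => (2 : ℝ) • ζ (π z) :=
      ((continuous_const_smul (2 : ℝ)).comp hζc).measurable.comp hπ
    have h2 : Continuous fun x : (EuclideanSpace ℝ (Fin 3)) => fderiv ℝ ζ x x := happ.comp (cD.prodMk continuous_id)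
    exact (h1.add (h2.measurable.comp hπ)).aestronglyMeasurable
  have b2 : ∀ z, ‖⟪U z + Wf z, (2 : ℝ) • ζ (π z) + fderiv ℝ ζ (π z) (π z)⟫‖ ≤
      (2 * K₀ + K₃) * ‖U z + Wf z‖ := fun z => by
    rw [mul_comm]
    refine (norm_inner_le_norm _ _).trans (mul_le_mul_of_nonneg_left ?_ (norm_nonneg _))
    calc ‖(2 : ℝ) • ζ (π z) + fderiv ℝ ζ (π z) (π z)‖
        ≤ ‖(2 : ℝ) • ζ (π z)‖ + ‖fderiv ℝ ζ (π z) (π z)‖ := norm_add_le _ _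
      _ ≤ 2 * K₀ + K₃ := by
          rw [norm_smul, Real.norm_eq_abs, abs_of_pos two_pos]
          exact add_le_add (mul_le_mul_of_nonneg_left (hK₀ _) zero_le_two) (hK₃ _)
  have i2 : Integrable
      (fun z => ⟪U z + Wf z, (2 : ℝ) • ζ (π z) + fderiv ℝ ζ (π z) (π z)⟫) μ :=
    (hu1.norm.const_mul (2 * K₀ + K₃)).mono' m2 (Eventually.of_forall b2)
  -- (3) `⟪U, Dζ (W + m)⟫`
  have m3 : AEStronglyMeasurable (fun z => ⟪U z, fderiv ℝ ζ (π z) (Wf z + m z)⟫) μ :=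
    hUm.inner (happ.comp_aestronglyMeasurable₂ hDm (hW.add hmm))
  have b3 : ∀ᵐ z ∂μ, ‖⟪U z, fderiv ℝ ζ (π z) (Wf z + m z)⟫‖ ≤
      K₁ * (M * ‖U z‖ + (‖U z‖ ^ 2 + ‖m z‖ ^ 2)) := by
    filter_upwards [hWM] with z hz
    have h1 : ‖fderiv ℝ ζ (π z) (Wf z + m z)‖ ≤ K₁ * (M + ‖m z‖) :=
      ((fderiv ℝ ζ (π z)).le_opNorm _).trans (mul_le_mul (hK₁ _)
        ((norm_add_le _ _).trans (add_le_add hz le_rfl)) (norm_nonneg _) hK₁0)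
    have h0 : 0 ≤ ‖U z‖ := norm_nonneg _
    have h0' : 0 ≤ ‖m z‖ := norm_nonneg _
    calc ‖⟪U z, fderiv ℝ ζ (π z) (Wf z + m z)⟫‖ ≤ ‖U z‖ * ‖fderiv ℝ ζ (π z) (Wf z + m z)‖ :=
          norm_inner_le_norm _ _
      _ ≤ ‖U z‖ * (K₁ * (M + ‖m z‖)) := mul_le_mul_of_nonneg_left h1 h0
      _ = K₁ * (M * ‖U z‖ + ‖U z‖ * ‖m z‖) := by ring
      _ ≤ K₁ * (M * ‖U z‖ + (‖U z‖ ^ 2 + ‖m z‖ ^ 2)) := by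
          gcongr
          nlinarith [sq_nonneg (‖U z‖ - ‖m z‖)]
  have i3 : Integrable (fun z => ⟪U z, fderiv ℝ ζ (π z) (Wf z + m z)⟫) μ :=
    (((hU1.norm.const_mul M).add (hU2.add hm2)).const_mul K₁).mono' m3 b3
  -- (4) `⟪W, Dζ u⟫`
  have m4 : AEStronglyMeasurable (fun z => ⟪Wf z, fderiv ℝ ζ (π z) (U z + Wf z)⟫) μ :=
    hW.inner (happ.comp_aestronglyMeasurable₂ hDm hum)
  have b4 : ∀ᵐ z ∂μ, ‖⟪Wf z, fderiv ℝ ζ (π z) (U z + Wf z)⟫‖ ≤ K₁ * M * ‖U z + Wf z‖ := by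
    filter_upwards [hWM] with z hz
    calc ‖⟪Wf z, fderiv ℝ ζ (π z) (U z + Wf z)⟫‖ ≤ ‖Wf z‖ * ‖fderiv ℝ ζ (π z) (U z + Wf z)‖ :=
          norm_inner_le_norm _ _
      _ ≤ M * (K₁ * ‖U z + Wf z‖) :=
          mul_le_mul hz (((fderiv ℝ ζ (π z)).le_opNorm _).trans
            (mul_le_mul_of_nonneg_right (hK₁ _) (norm_nonneg _))) (norm_nonneg _) hM0
      _ = K₁ * M * ‖U z + Wf z‖ := by ring
  have i4 : Integrable (fun z => ⟪Wf z, fderiv ℝ ζ (π z) (U z + Wf z)⟫) μ :=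
    (hu1.norm.const_mul (K₁ * M)).mono' m4 b4
  -- (5) `q div ζ`
  have m5 : AEStronglyMeasurable (fun z => q z * VectorCalculus.divergence ζ (π z)) μ :=
    hq.1.mul (cdiv.measurable.comp hπ).aestronglyMeasurable
  have b5 : ∀ z, ‖q z * VectorCalculus.divergence ζ (π z)‖ ≤ 3 * K₁ * |q z| := fun z => by
    rw [norm_mul, Real.norm_eq_abs, mul_comm (3 * K₁)]
    exact mul_le_mul_of_nonneg_left (hdivb _) (abs_nonneg _)
  have i5 : Integrable (fun z => q z * VectorCalculus.divergence ζ (π z)) μ := by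
    refine (hq.abs.const_mul (3 * K₁)).mono' m5 (Eventually.of_forall fun z => ?_)
    exact b5 z
  -- integrability of the remainder
  have hI : Integrable (fun z => ⟪U z + Wf z, Δ ζ (π z)⟫ -
      ⟪U z + Wf z, (2 : ℝ) • ζ (π z) + fderiv ℝ ζ (π z) (π z)⟫ +
      ⟪U z, fderiv ℝ ζ (π z) (Wf z + m z)⟫ + ⟪Wf z, fderiv ℝ ζ (π z) (U z + Wf z)⟫ +
      q z * VectorCalculus.divergence ζ (π z)) μ := (((i1.sub i2).add i3).add i4).add i5
  refine ⟨hI, ?_⟩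
  -- the dominating function and its integral
  set D : X → ℝ := fun z => K₂ * ‖U z + Wf z‖ + (2 * K₀ + K₃) * ‖U z + Wf z‖ +
    K₁ * (M * ‖U z‖ + (‖U z‖ ^ 2 + ‖m z‖ ^ 2)) + K₁ * M * ‖U z + Wf z‖ + 3 * K₁ * |q z| with hD
  have hDi : Integrable D μ :=
    ((((hu1.norm.const_mul K₂).add (hu1.norm.const_mul (2 * K₀ + K₃))).add
      (((hU1.norm.const_mul M).add (hU2.add hm2)).const_mul K₁)).add
      (hu1.norm.const_mul (K₁ * M))).add (hq.abs.const_mul (3 * K₁))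
  have hdom : ∀ᵐ z ∂μ, ‖⟪U z + Wf z, Δ ζ (π z)⟫ -
      ⟪U z + Wf z, (2 : ℝ) • ζ (π z) + fderiv ℝ ζ (π z) (π z)⟫ +
      ⟪U z, fderiv ℝ ζ (π z) (Wf z + m z)⟫ + ⟪Wf z, fderiv ℝ ζ (π z) (U z + Wf z)⟫ +
      q z * VectorCalculus.divergence ζ (π z)‖ ≤ D z := by
    filter_upwards [b3, b4] with z h3 h4
    have h1 := b1 z
    have h2 := b2 z
    have h5 := b5 z
    rw [hD]
    refine (norm_add_le _ _).trans (add_le_add ((norm_add_le _ _).trans (add_le_add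
      ((norm_add_le _ _).trans (add_le_add ((norm_sub_le _ _).trans (add_le_add h1 h2)) h3))
      h4)) h5)
  have hint_D : ∫ z, D z ∂μ = (K₂ + 2 * K₀ + K₃ + K₁ * M) * (∫ z, ‖U z + Wf z‖ ∂μ) +
      K₁ * (M * (∫ z, ‖U z‖ ∂μ) + ∫ z, (‖U z‖ ^ 2 + ‖m z‖ ^ 2) ∂μ) +
      3 * K₁ * ∫ z, |q z| ∂μ := by
    rw [hD]
    have e1 := integral_add ((((hu1.norm.const_mul K₂).add (hu1.norm.const_mul (2 * K₀ + K₃))).add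
      (((hU1.norm.const_mul M).add (hU2.add hm2)).const_mul K₁)).add
      (hu1.norm.const_mul (K₁ * M))) (hq.abs.const_mul (3 * K₁))
    have e2 := integral_add (((hu1.norm.const_mul K₂).add (hu1.norm.const_mul (2 * K₀ + K₃))).add
      (((hU1.norm.const_mul M).add (hU2.add hm2)).const_mul K₁)) (hu1.norm.const_mul (K₁ * M))
    have e3 := integral_add ((hu1.norm.const_mul K₂).add (hu1.norm.const_mul (2 * K₀ + K₃)))
      (((hU1.norm.const_mul M).add (hU2.add hm2)).const_mul K₁)
    have e4 := integral_add (hu1.norm.const_mul K₂) (hu1.norm.const_mul (2 * K₀ + K₃))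
    have e5 := integral_add (hU1.norm.const_mul M) (hU2.add hm2)
    simp only [Pi.add_apply] at e1 e2 e3 e4 e5
    rw [e1, e2, e3, e4, MeasureTheory.integral_const_mul, MeasureTheory.integral_const_mul,
      MeasureTheory.integral_const_mul, MeasureTheory.integral_const_mul,
      MeasureTheory.integral_const_mul, e5, MeasureTheory.integral_const_mul]
    ring
  calc |∫ z, (⟪U z + Wf z, Δ ζ (π z)⟫ -
        ⟪U z + Wf z, (2 : ℝ) • ζ (π z) + fderiv ℝ ζ (π z) (π z)⟫ +
        ⟪U z, fderiv ℝ ζ (π z) (Wf z + m z)⟫ + ⟪Wf z, fderiv ℝ ζ (π z) (U z + Wf z)⟫ +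
        q z * VectorCalculus.divergence ζ (π z)) ∂μ|
      ≤ ∫ z, ‖⟪U z + Wf z, Δ ζ (π z)⟫ -
        ⟪U z + Wf z, (2 : ℝ) • ζ (π z) + fderiv ℝ ζ (π z) (π z)⟫ +
        ⟪U z, fderiv ℝ ζ (π z) (Wf z + m z)⟫ + ⟪Wf z, fderiv ℝ ζ (π z) (U z + Wf z)⟫ +
        q z * VectorCalculus.divergence ζ (π z)‖ ∂μ := by
        rw [← Real.norm_eq_abs]; exact norm_integral_le_integral_norm _
    _ ≤ ∫ z, D z ∂μ := integral_mono_ae hI.norm hDi hdom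
    _ = _ := hint_D

end Remainder

/-! ### Testing the momentum equation with `χ(t) ζ(y)`; the pairing as a primitive -/

section Identity

variable {T : ℝ} {W : ℝ → (EuclideanSpace ℝ (Fin 3)) → (EuclideanSpace ℝ (Fin 3))} {η : (EuclideanSpace ℝ (Fin 3)) → ℝ} {ε : ℝ} {C : ℝ≥0} {U : ℝ → (EuclideanSpace ℝ (Fin 3)) → (EuclideanSpace ℝ (Fin 3))}
  {p : ℝ → (EuclideanSpace ℝ (Fin 3)) → ℝ} {a b : ℝ} {x₀ : (EuclideanSpace ℝ (Fin 3))} {R : ℝ}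

/-- The classes on the cylinder feeding the remainder lemma: `U, η_ε * U ∈ L²(S)`, `W` bounded
a.e. on `S = (a,b) × B(x₀,R)`. [folklore] -/
theorem IsMollifiedPeriodicWeakSolution.cylinder_classes
    (h : IsMollifiedPeriodicWeakSolution T W η ε C U p) (hWc : Continuous (uncurry W))
    (hη : IsMollifyingKernel η) (hε : 0 < ε) {M : ℝ}
    (hM : ∀ s ∈ Icc a b, ∀ y ∈ closedBall x₀ R, ‖W s y‖ ≤ M) :
    MemLp (fun w : ℝ × (EuclideanSpace ℝ (Fin 3)) => U w.1 w.2) 2 (volume.restrict (Ioo a b ×ˢ ball x₀ R)) ∧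
    AEStronglyMeasurable (fun w : ℝ × (EuclideanSpace ℝ (Fin 3)) => W w.1 w.2) (volume.restrict (Ioo a b ×ˢ ball x₀ R)) ∧
    (∀ᵐ w ∂(volume.restrict (Ioo a b ×ˢ ball x₀ R)), ‖W w.1 w.2‖ ≤ M) ∧
    MemLp (fun w : ℝ × (EuclideanSpace ℝ (Fin 3)) => mollify η ε U w.1 w.2) 2
      (volume.restrict (Ioo a b ×ˢ ball x₀ R)) := by
  obtain ⟨hUi, hU2⟩ := h.integrable_cylinder_velocity a b x₀ R
  obtain ⟨hmi, hm2⟩ := h.integrable_cylinder_mollify hη hε a b x₀ R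
  refine ⟨(memLp_two_iff_integrable_sq_norm hUi.1).2 hU2, hWc.aestronglyMeasurable.restrict, ?_,
    (memLp_two_iff_integrable_sq_norm hmi.1).2 hm2⟩
  filter_upwards [ae_restrict_mem (measurableSet_Ioo.prod measurableSet_ball)] with z hz
  exact hM z.1 (Ioo_subset_Icc_self hz.1) z.2 (ball_subset_closedBall hz.2)

/-- **Testing the mollified perturbed Leray system with `χ(t) ζ(y)` on a cylinder.** For a
`T`-periodic weak solution `(U, p)` of the mollified perturbed Leray system around the `C¹`
profile `W` (`u = U + W`, `b = W + η_ε * U`), a smooth `χ` compactly supported in `(a, b)` and a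
test field `ζ` on `B(x₀, R)`:
`∫_a^b (χ'(t) ∫_B ⟪u(t), ζ⟫ + χ(t) ∫_B (⟪u, Δζ⟫ − ⟪u, 2ζ + Dζ y⟫ + ⟪U, Dζ b⟫ + ⟪W, Dζ u⟫ + p div ζ)(t)) dt = 0`
— the distributional identity `IsMollifiedPeriodicWeakSolution.distributional` for `ψ = χ ⊗ ζ`
followed by Fubini ([BT1] §2: the mollified system "in the sense of distributions"). [cite: BradshawTsai2017AHP, §2 (mollified perturbed Leray system) and proof of Thm 2.4] -/
theorem IsMollifiedPeriodicWeakSolution.setIntegral_deriv_mul_pairing_add_eq_zero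
    (h : IsMollifiedPeriodicWeakSolution T W η ε C U p) (hT : 0 < T)
    (hW : ContDiff ℝ 1 (uncurry W)) (hη : IsMollifyingKernel η) (hε : 0 < ε)
    {χ : ℝ → ℝ} (hχ : ContDiff ℝ (⊤ : ℕ∞) χ) (hχc : HasCompactSupport χ)
    (hχI : tsupport χ ⊆ Ioo a b) {ζ : (EuclideanSpace ℝ (Fin 3)) → (EuclideanSpace ℝ (Fin 3))}
    (hζ : FunctionSpaces.IsTestFunctionOn (⟨ball x₀ R, isOpen_ball⟩ : Opens (EuclideanSpace ℝ (Fin 3))) ζ) :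
    ∫ t in Ioo a b,
      ((deriv χ t * ∫ x in ball x₀ R, ⟪U t x + W t x, ζ x⟫) +
        χ t * ∫ x in ball x₀ R, (⟪U t x + W t x, Δ ζ x⟫ -
          ⟪U t x + W t x, (2 : ℝ) • ζ x + fderiv ℝ ζ x x⟫ +
          ⟪U t x, fderiv ℝ ζ x (W t x + mollify η ε U t x)⟫ +
          ⟪W t x, fderiv ℝ ζ x (U t x + W t x)⟫ +
          p t x * VectorCalculus.divergence ζ x)) = 0 := by
  obtain ⟨K₀, K₁, K₂, hK₀, hK₁, hK₂⟩ := exists_bounds_of_isTestFunctionOn hζ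
  have hK₃ := norm_fderiv_apply_self_le hζ hK₁
  have hζd : Differentiable ℝ ζ := hζ.contDiff.differentiable (by simp)
  have hζ2 : ContDiff ℝ 2 ζ := hζ.contDiff.of_le (by norm_cast)
  have hχd : Differentiable ℝ χ := hχ.differentiable (by simp)
  obtain ⟨Cχ, hCχ⟩ := hχ.continuous.bounded_above_of_compact_support hχc
  obtain ⟨Cχ', hCχ'⟩ := (hχ.continuous_deriv (by simp)).bounded_above_of_compact_support
    hχc.deriv
  obtain ⟨M, hM0, hMW, -⟩ := exists_profile_bound hW a b x₀ R
  -- notation and finiteness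
  set S : Set (ℝ × (EuclideanSpace ℝ (Fin 3))) := Ioo a b ×ˢ ball x₀ R with hS
  have hSm : MeasurableSet S := measurableSet_Ioo.prod measurableSet_ball
  haveI : IsFiniteMeasure (volume.restrict S) :=
    NSCylinder.isFiniteMeasure_restrict (Ω := ⟨ball x₀ R, isOpen_ball⟩) isBounded_ball a b
  -- the classes on `S`
  obtain ⟨-, hu, -⟩ := h.integrable_cylinder_velocity_add hW.continuous hMW
  obtain ⟨hUmem, hWm, hWbd, hmmem⟩ := h.cylinder_classes hW.continuous hη hε hMW
  have hpi := h.integrable_cylinder_pressure hT a b x₀ R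
  -- the space–time test function and the distributional identity
  have hψ : IsSpaceTimeTestOn (⟨Ioo a b ×ˢ ball x₀ R, isOpen_Ioo.prod isOpen_ball⟩ :
      Opens (ℝ × (EuclideanSpace ℝ (Fin 3)))) (fun s x => χ s • ζ x) :=
    isSpaceTimeTestOn_prod_smul isOpen_Ioo isOpen_ball hχ hχc hχI hζ
  have key := h.distributional _ (hψ.mono le_top)
  -- the integrand vanishes off `S`
  have hvan : ∀ z : ℝ × (EuclideanSpace ℝ (Fin 3)), z ∉ S →
      ⟪U z.1 z.2 + W z.1 z.2, timeDeriv (fun s x => χ s • ζ x) z.1 z.2⟫ +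
        ⟪U z.1 z.2 + W z.1 z.2, Δ ((fun s x => χ s • ζ x) z.1) z.2⟫ -
        ⟪U z.1 z.2 + W z.1 z.2, (2 : ℝ) • (fun s x => χ s • ζ x) z.1 z.2 +
          fderiv ℝ ((fun s x => χ s • ζ x) z.1) z.2 z.2⟫ +
        ⟪U z.1 z.2, convect (W z.1 + mollify η ε U z.1) ((fun s x => χ s • ζ x) z.1) z.2⟫ +
        ⟪W z.1 z.2, convect (U z.1 + W z.1) ((fun s x => χ s • ζ x) z.1) z.2⟫ +
        p z.1 z.2 * VectorCalculus.divergence ((fun s x => χ s • ζ x) z.1) z.2 = 0 := by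
    intro z hz
    have hz' : z ∉ tsupport (uncurry fun s x => χ s • ζ x) := fun h' => hz (hψ.tsupport_subset h')
    obtain ⟨h1, h2, h3, h4, h5⟩ := testField_weights_eq_zero_of_notMem_tsupport hz'
    simp only [convect, h1, h2, h3, h4, h5, inner_zero_right, smul_zero,
      _root_.zero_apply, mul_zero, add_zero, sub_zero]
  rw [← setIntegral_eq_integral_of_forall_compl_eq_zero hvan] at key
  -- the remainder integrand on `S`
  set G : ℝ × (EuclideanSpace ℝ (Fin 3)) → ℝ := fun w => ⟪U w.1 w.2 + W w.1 w.2, Δ ζ w.2⟫ -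
      ⟪U w.1 w.2 + W w.1 w.2, (2 : ℝ) • ζ w.2 + fderiv ℝ ζ w.2 w.2⟫ +
      ⟪U w.1 w.2, fderiv ℝ ζ w.2 (W w.1 w.2 + mollify η ε U w.1 w.2)⟫ +
      ⟪W w.1 w.2, fderiv ℝ ζ w.2 (U w.1 w.2 + W w.1 w.2)⟫ +
      p w.1 w.2 * VectorCalculus.divergence ζ w.2 with hG
  have iU : Integrable (fun w : ℝ × (EuclideanSpace ℝ (Fin 3)) => ⟪U w.1 w.2 + W w.1 w.2, ζ w.2⟫)
      (volume.restrict S) :=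
    NSCylinder.integrable_inner_test (Ω := ⟨ball x₀ R, isOpen_ball⟩)
      (u := fun t x => U t x + W t x) hu hζ.contDiff.continuous hK₀
  have iG : Integrable G (volume.restrict S) :=
    (integrable_remainder_and_abs_integral_le measurable_snd hUmem hWm hM0 hWbd hmmem hpi hζ2
      hK₀ hK₁ hK₂ hK₃).1
  have iU' : Integrable (fun w : ℝ × (EuclideanSpace ℝ (Fin 3)) => deriv χ w.1 * ⟪U w.1 w.2 + W w.1 w.2, ζ w.2⟫)
      (volume.restrict S) :=
    integrable_time_mul iU (hχ.continuous_deriv (by simp)) (C := Cχ')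
      fun s => by simpa [Real.norm_eq_abs] using hCχ' s
  have iG' : Integrable (fun w : ℝ × (EuclideanSpace ℝ (Fin 3)) => χ w.1 * G w) (volume.restrict S) :=
    integrable_time_mul iG hχ.continuous (C := Cχ) fun s => by simpa [Real.norm_eq_abs] using hCχ s
  -- rewrite the tested integrand in product form
  have key' : ∫ w in S, (deriv χ w.1 * ⟪U w.1 w.2 + W w.1 w.2, ζ w.2⟫ + χ w.1 * G w) = 0 := by
    refine Eq.trans (setIntegral_congr_fun hSm fun w _ => ?_) key
    rw [hG]
    dsimp only
    rw [timeDeriv_prod_smul hχd, convect_fun_const_smul _ (hζd w.2),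
      convect_fun_const_smul _ (hζd w.2), laplacian_fun_const_smul hζ2,
      divergence_fun_const_smul (hζd w.2), fderiv_fun_const_smul (hζd w.2)]
    simp only [inner_smul_right, inner_add_right, convect, _root_.smul_apply, Pi.add_apply,
      smul_smul]
    ring
  -- Fubini
  rw [FunctionSpaces.AubinLions.volume_restrict_prod] at key' iU iG iU' iG'
  have iS : Integrable (fun w : ℝ × (EuclideanSpace ℝ (Fin 3)) => deriv χ w.1 * ⟪U w.1 w.2 + W w.1 w.2, ζ w.2⟫ +
      χ w.1 * G w) (((volume : Measure ℝ).restrict (Ioo a b)).prod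
        ((volume : Measure (EuclideanSpace ℝ (Fin 3))).restrict (ball x₀ R))) := iU'.add iG'
  rw [integral_prod _ iS] at key'
  have hae : ∀ᵐ t ∂((volume : Measure ℝ).restrict (Ioo a b)),
      (∫ x in ball x₀ R, (deriv χ t * ⟪U t x + W t x, ζ x⟫ + χ t * G (t, x))) =
        (deriv χ t * ∫ x in ball x₀ R, ⟪U t x + W t x, ζ x⟫) +
          χ t * ∫ x in ball x₀ R, G (t, x) := by
    filter_upwards [iU.prod_right_ae, iG.prod_right_ae] with t h1 h2
    rw [integral_add (h1.const_mul _) (h2.const_mul _), MeasureTheory.integral_const_mul,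
      MeasureTheory.integral_const_mul]
  rw [← integral_congr_ae hae]
  exact key'

/-- **The pairing is a primitive, a.e.** In the setting of
`setIntegral_deriv_mul_pairing_add_eq_zero`: for some constant `c` and a.e. `t ∈ (a, b)`,
`∫_B ⟪u(t), ζ⟫ = c + ∫_{(a,t]} f_ζ` with the remainder `f_ζ` (du Bois-Reymond,
`exists_ae_eq_const_add_primitive`). [folklore] -/
theorem IsMollifiedPeriodicWeakSolution.exists_ae_pairing_eq_const_add_primitive
    (h : IsMollifiedPeriodicWeakSolution T W η ε C U p) (hT : 0 < T)
    (hW : ContDiff ℝ 1 (uncurry W)) (hη : IsMollifyingKernel η) (hε : 0 < ε) {ζ : (EuclideanSpace ℝ (Fin 3)) → (EuclideanSpace ℝ (Fin 3))}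
    (hζ : FunctionSpaces.IsTestFunctionOn (⟨ball x₀ R, isOpen_ball⟩ : Opens (EuclideanSpace ℝ (Fin 3))) ζ) :
    ∃ c : ℝ, ∀ᵐ t ∂(volume.restrict (Ioo a b)),
      (∫ x in ball x₀ R, ⟪U t x + W t x, ζ x⟫) = c + ∫ s in Ioc a t,
        ∫ x in ball x₀ R, (⟪U s x + W s x, Δ ζ x⟫ -
          ⟪U s x + W s x, (2 : ℝ) • ζ x + fderiv ℝ ζ x x⟫ +
          ⟪U s x, fderiv ℝ ζ x (W s x + mollify η ε U s x)⟫ +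
          ⟪W s x, fderiv ℝ ζ x (U s x + W s x)⟫ +
          p s x * VectorCalculus.divergence ζ x) := by
  obtain ⟨K₀, K₁, K₂, hK₀, hK₁, hK₂⟩ := exists_bounds_of_isTestFunctionOn hζ
  have hK₃ := norm_fderiv_apply_self_le hζ hK₁
  have hζ2 : ContDiff ℝ 2 ζ := hζ.contDiff.of_le (by norm_cast)
  obtain ⟨M, hM0, hMW, -⟩ := exists_profile_bound hW a b x₀ R
  haveI : IsFiniteMeasure (volume.restrict (Ioo a b ×ˢ ball x₀ R)) :=
    NSCylinder.isFiniteMeasure_restrict (Ω := ⟨ball x₀ R, isOpen_ball⟩) isBounded_ball a b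
  obtain ⟨-, hu, -⟩ := h.integrable_cylinder_velocity_add hW.continuous hMW
  obtain ⟨hUmem, hWm, hWbd, hmmem⟩ := h.cylinder_classes hW.continuous hη hε hMW
  have hpi := h.integrable_cylinder_pressure hT a b x₀ R
  have iU : Integrable (fun w : ℝ × (EuclideanSpace ℝ (Fin 3)) => ⟪U w.1 w.2 + W w.1 w.2, ζ w.2⟫)
      (volume.restrict (Ioo a b ×ˢ ball x₀ R)) :=
    NSCylinder.integrable_inner_test (Ω := ⟨ball x₀ R, isOpen_ball⟩)
      (u := fun t x => U t x + W t x) hu hζ.contDiff.continuous hK₀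
  have iG := (integrable_remainder_and_abs_integral_le measurable_snd hUmem hWm hM0 hWbd hmmem
    hpi hζ2 hK₀ hK₁ hK₂ hK₃).1
  rw [FunctionSpaces.AubinLions.volume_restrict_prod] at iU iG
  refine exists_ae_eq_const_add_primitive iU.integral_prod_left iG.integral_prod_left
    fun χ hχ hχc hχI => ?_
  exact h.setIntegral_deriv_mul_pairing_add_eq_zero hT hW hη hε hχ hχc hχI hζ

end Identity

/-! ### The modulus of continuity of the pairings -/

section Modulus

variable {T : ℝ} {W : ℝ → (EuclideanSpace ℝ (Fin 3)) → (EuclideanSpace ℝ (Fin 3))} {η : (EuclideanSpace ℝ (Fin 3)) → ℝ} {ε : ℝ} {C : ℝ≥0} {U : ℝ → (EuclideanSpace ℝ (Fin 3)) → (EuclideanSpace ℝ (Fin 3))}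
  {p : ℝ → (EuclideanSpace ℝ (Fin 3)) → ℝ} {a b : ℝ} {x₀ : (EuclideanSpace ℝ (Fin 3))} {R : ℝ}

/-- **The remainder is bounded by uniform constants and the pressure slice, a.e. in time.**
With `‖W‖ ≤ M` on `[a,b] × B̄(x₀,R)`, `V = |B(x₀,R)|`, `L = ‖η‖_{L¹}` and the bounds `K₀, …, K₃`
of `ζ`: for a.e. `t ∈ (a, b)`,
`|f_ζ(t)| ≤ (K₂ + 2K₀ + K₃ + K₁M)(V + C + MV) + K₁(M(V + C) + (C + L²C)) + 3K₁ ∫_B |p(t)|`.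
[folklore] -/
theorem IsMollifiedPeriodicWeakSolution.ae_abs_remainder_le
    (h : IsMollifiedPeriodicWeakSolution T W η ε C U p) (hT : 0 < T)
    (hWc : Continuous (uncurry W)) (hη : IsMollifyingKernel η) (hε : 0 < ε) {M : ℝ}
    (hM0 : 0 ≤ M) (hM : ∀ s ∈ Icc a b, ∀ y ∈ closedBall x₀ R, ‖W s y‖ ≤ M)
    {ζ : (EuclideanSpace ℝ (Fin 3)) → (EuclideanSpace ℝ (Fin 3))} (hζ2 : ContDiff ℝ 2 ζ) {K₀ K₁ K₂ K₃ : ℝ} (hK₀ : ∀ x, ‖ζ x‖ ≤ K₀)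
    (hK₁ : ∀ x, ‖fderiv ℝ ζ x‖ ≤ K₁) (hK₂ : ∀ x, ‖Δ ζ x‖ ≤ K₂)
    (hK₃ : ∀ x, ‖fderiv ℝ ζ x x‖ ≤ K₃) :
    ∀ᵐ t ∂(volume.restrict (Ioo a b)),
      |∫ x in ball x₀ R, (⟪U t x + W t x, Δ ζ x⟫ -
          ⟪U t x + W t x, (2 : ℝ) • ζ x + fderiv ℝ ζ x x⟫ +
          ⟪U t x, fderiv ℝ ζ x (W t x + mollify η ε U t x)⟫ +
          ⟪W t x, fderiv ℝ ζ x (U t x + W t x)⟫ +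
          p t x * VectorCalculus.divergence ζ x)| ≤
        (K₂ + 2 * K₀ + K₃ + K₁ * M) *
            ((volume (ball x₀ R)).toReal + (C : ℝ) + M * (volume (ball x₀ R)).toReal) +
          K₁ * (M * ((volume (ball x₀ R)).toReal + (C : ℝ)) +
            ((C : ℝ) + (∫⁻ y, ‖η y‖ₑ).toReal ^ 2 * (C : ℝ))) +
          3 * K₁ * ∫ x in ball x₀ R, |p t x| := by
  haveI : IsFiniteMeasure ((volume : Measure (EuclideanSpace ℝ (Fin 3))).restrict (ball x₀ R)) :=
    ⟨by rw [Measure.restrict_apply_univ]; exact measure_ball_lt_top⟩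
  have hK₁0 : 0 ≤ K₁ := (norm_nonneg _).trans (hK₁ 0)
  have hK₀0 : 0 ≤ K₀ := (norm_nonneg _).trans (hK₀ 0)
  have hK₂0 : 0 ≤ K₂ := (norm_nonneg _).trans (hK₂ 0)
  have hK₃0 : 0 ≤ K₃ := (norm_nonneg _).trans (hK₃ 0)
  set V : ℝ := (volume (ball x₀ R)).toReal with hV
  set L : ℝ≥0∞ := ∫⁻ y, ‖η y‖ₑ with hL
  have hLtop : L ≠ ⊤ := hη.lintegral_enorm_lt_top.ne
  have hCtop : ((C : ℝ≥0) : ℝ≥0∞) ≠ ⊤ := ENNReal.coe_ne_top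
  -- the a.e. data: slice measurability, mollified slice, pressure slice
  have hUm := h.aestronglyMeasurable_velocity
  have hmm := hη.aestronglyMeasurable_mollify ε hUm
  have hmslice : ∀ᵐ s : ℝ, AEStronglyMeasurable (mollify η ε U s) (volume : Measure (EuclideanSpace ℝ (Fin 3))) := by
    rw [Measure.volume_eq_prod] at hmm; exact hmm.prodMk_left
  have hpi := h.integrable_cylinder_pressure hT a b x₀ R
  rw [FunctionSpaces.AubinLions.volume_restrict_prod] at hpi
  filter_upwards [ae_restrict_mem measurableSet_Ioo, ae_restrict_of_ae h.ae_memLp_two_slice,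
    ae_restrict_of_ae hmslice, ae_restrict_of_ae (h.ae_lintegral_mollify_sq_le hη hε),
    hpi.prod_right_ae] with t ht hUt hmt hmbt hpt
  have hpt' : Integrable (fun x => p t x) (volume.restrict (ball x₀ R)) := hpt
  -- the classes of the slices on the ball
  have hU2 : MemLp (U t) 2 (volume.restrict (ball x₀ R)) := hUt.1.restrict _
  have hmfin : (L ^ 2 * (C : ℝ≥0∞)) ≠ ⊤ := ENNReal.mul_ne_top (ENNReal.pow_ne_top hLtop) hCtop
  have hm2' : MemLp (mollify η ε U t) 2 (volume : Measure (EuclideanSpace ℝ (Fin 3))) := by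
    refine ⟨hmt, ?_⟩
    rw [FunctionSpaces.AubinLions.eLpNorm_two_eq_rpow]
    exact ENNReal.rpow_lt_top_of_nonneg (by norm_num) (ne_top_of_le_ne_top hmfin hmbt)
  have hm2 : MemLp (mollify η ε U t) 2 (volume.restrict (ball x₀ R)) := hm2'.restrict _
  have hWt : Continuous (W t) := hWc.comp (continuous_const.prodMk continuous_id)
  have hWM : ∀ᵐ x ∂(volume.restrict (ball x₀ R)), ‖W t x‖ ≤ M := by
    filter_upwards [ae_restrict_mem measurableSet_ball] with x hx
    exact hM t (Ioo_subset_Icc_self ht) x (ball_subset_closedBall hx)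
  -- the generic bound
  have key := (integrable_remainder_and_abs_integral_le (μ := volume.restrict (ball x₀ R))
    measurable_id hU2 hWt.aestronglyMeasurable hM0 hWM hm2 hpt' hζ2 hK₀ hK₁ hK₂ hK₃).2
  simp only [id] at key
  refine key.trans ?_
  -- the slice integrals are bounded by the uniform constants
  have hEU : ∫ x in ball x₀ R, ‖U t x‖ ^ 2 ≤ (C : ℝ) := by
    have := NSCylinder.integral_norm_sq_le_toReal (Ω := ⟨ball x₀ R, isOpen_ball⟩) hCtop
      hU2.1 ((setLIntegral_le_lintegral _ _).trans (h.energy_le t))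
    simpa using this
  have hEm : ∫ x in ball x₀ R, ‖mollify η ε U t x‖ ^ 2 ≤ L.toReal ^ 2 * (C : ℝ) := by
    have := NSCylinder.integral_norm_sq_le_toReal (Ω := ⟨ball x₀ R, isOpen_ball⟩) hmfin
      hm2.1 ((setLIntegral_le_lintegral _ _).trans hmbt)
    rw [ENNReal.toReal_mul, ENNReal.toReal_pow] at this
    simpa using this
  have hiU1 : Integrable (U t) (volume.restrict (ball x₀ R)) := hU2.integrable one_le_two
  have hiU2 : Integrable (fun x => ‖U t x‖ ^ 2) (volume.restrict (ball x₀ R)) :=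
    (memLp_two_iff_integrable_sq_norm hU2.1).1 hU2
  have him2 : Integrable (fun x => ‖mollify η ε U t x‖ ^ 2) (volume.restrict (ball x₀ R)) :=
    (memLp_two_iff_integrable_sq_norm hm2.1).1 hm2
  have hU1 : ∫ x in ball x₀ R, ‖U t x‖ ≤ V + (C : ℝ) := by
    calc ∫ x in ball x₀ R, ‖U t x‖ ≤ ∫ x in ball x₀ R, (1 + ‖U t x‖ ^ 2) :=
          integral_mono hiU1.norm ((integrable_const _).add hiU2) fun x =>
            NSCylinder.norm_le_one_add_sq _
      _ = V + ∫ x in ball x₀ R, ‖U t x‖ ^ 2 := by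
          rw [integral_add (integrable_const _) hiU2, MeasureTheory.integral_const,
            measureReal_restrict_apply_univ, smul_eq_mul, mul_one, measureReal_def]
      _ ≤ V + (C : ℝ) := by gcongr
  have hu1 : ∫ x in ball x₀ R, ‖U t x + W t x‖ ≤ V + (C : ℝ) + M * V := by
    have hiW : Integrable (fun _ => (M : ℝ)) (volume.restrict (ball x₀ R)) := integrable_const _
    have hWmem : MemLp (W t) 2 (volume.restrict (ball x₀ R)) :=
      (memLp_top_of_bound hWt.aestronglyMeasurable M hWM).mono_exponent le_top
    have hiu : Integrable (fun x => U t x + W t x) (volume.restrict (ball x₀ R)) :=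
      (hU2.add hWmem).integrable one_le_two
    calc ∫ x in ball x₀ R, ‖U t x + W t x‖ ≤ ∫ x in ball x₀ R, (‖U t x‖ + M) := by
          refine integral_mono_ae hiu.norm (hiU1.norm.add hiW) ?_
          filter_upwards [hWM] with x hx
          exact (norm_add_le _ _).trans (add_le_add le_rfl hx)
      _ = (∫ x in ball x₀ R, ‖U t x‖) + M * V := by
          rw [integral_add hiU1.norm hiW, MeasureTheory.integral_const,
            measureReal_restrict_apply_univ, smul_eq_mul, measureReal_def, mul_comm]
      _ ≤ V + (C : ℝ) + M * V := by gcongr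
  have hUm2 : ∫ x in ball x₀ R, (‖U t x‖ ^ 2 + ‖mollify η ε U t x‖ ^ 2) ≤
      (C : ℝ) + L.toReal ^ 2 * (C : ℝ) := by
    rw [integral_add hiU2 him2]
    exact add_le_add hEU hEm
  have hA0 : 0 ≤ K₂ + 2 * K₀ + K₃ + K₁ * M :=
    add_nonneg (add_nonneg (add_nonneg hK₂0 (mul_nonneg zero_le_two hK₀0)) hK₃0)
      (mul_nonneg hK₁0 hM0)
  gcongr

/-- **Modulus of continuity of the pairings of the perturbation, up to a null set of times.** For
a `T`-periodic weak solution `(U, p)` of the mollified perturbed Leray system around the `C¹`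
profile `W` with `‖W‖, ‖D(uncurry W)‖ ≤ M` on `[a,b] × B̄(x₀,R)`, and a test field `ζ` on
`B(x₀,R)` with `‖ζ‖ ≤ K₀`, `‖Dζ‖ ≤ K₁`, `‖Δζ‖ ≤ K₂`, there is a full-measure set `S ⊆ (a, b)` of
times with `|∫_B ⟪U(t), ζ⟫ − ∫_B ⟪U(s), ζ⟫| ≤ A |t − s| + B |t − s|^{1/3}` for `t, s ∈ S`, the
constants depending on the solution only through `C` (and on `T`, `η`, `M`, the cylinder and
`ζ`): the momentum equation gives the primitive representation of the pairing of `u = U + W`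
(`exists_ae_pairing_eq_const_add_primitive`, `ae_abs_remainder_le`, Hölder in time for the
pressure), and the pairing of `W` is Lipschitz (`abs_setIntegral_inner_profile_sub_le`). [folklore] -/
theorem IsMollifiedPeriodicWeakSolution.exists_fullMeasure_pairing_modulus
    (h : IsMollifiedPeriodicWeakSolution T W η ε C U p) (hT : 0 < T)
    (hW : ContDiff ℝ 1 (uncurry W)) (hη : IsMollifyingKernel η) (hε : 0 < ε) {M : ℝ}
    (hM0 : 0 ≤ M) (hM : ∀ s ∈ Icc a b, ∀ y ∈ closedBall x₀ R, ‖W s y‖ ≤ M)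
    (hM' : ∀ s ∈ Icc a b, ∀ y ∈ closedBall x₀ R, ‖fderiv ℝ (uncurry W) (s, y)‖ ≤ M)
    {ζ : (EuclideanSpace ℝ (Fin 3)) → (EuclideanSpace ℝ (Fin 3))} (hζ : FunctionSpaces.IsTestFunctionOn (⟨ball x₀ R, isOpen_ball⟩ : Opens (EuclideanSpace ℝ (Fin 3))) ζ)
    {K₀ K₁ K₂ : ℝ} (hK₀ : ∀ x, ‖ζ x‖ ≤ K₀) (hK₁ : ∀ x, ‖fderiv ℝ ζ x‖ ≤ K₁)
    (hK₂ : ∀ x, ‖Δ ζ x‖ ≤ K₂) :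
    ∃ S : Set ℝ, (∀ᵐ t ∂(volume.restrict (Ioo a b)), t ∈ S) ∧ ∀ t ∈ S, ∀ s ∈ S,
      |(∫ x in ball x₀ R, ⟪U t x, ζ x⟫) - ∫ x in ball x₀ R, ⟪U s x, ζ x⟫| ≤
        ((K₂ + 2 * K₀ + K₁ * (‖x₀‖ + |R|) + K₁ * M) *
            ((volume (ball x₀ R)).toReal + (C : ℝ) + M * (volume (ball x₀ R)).toReal) +
          K₁ * (M * ((volume (ball x₀ R)).toReal + (C : ℝ)) +
            ((C : ℝ) + (∫⁻ y, ‖η y‖ₑ).toReal ^ 2 * (C : ℝ))) +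
          M * K₀ * (volume (ball x₀ R)).toReal) * |t - s| +
        3 * K₁ * (((volume (ball x₀ R)) ^ (1 / 2 : ℝ) *
            (volume (Ioo a b ×ˢ ball x₀ R) ^ (1 / 10 : ℝ) *
              (2 * (⌈(b - a) / T⌉₊ + 1 : ℕ) * (C : ℝ≥0∞)) ^ (9 / 10 : ℝ))) ^ (2 / 3 : ℝ)).toReal *
          |t - s| ^ (1 / 3 : ℝ) := by
  have hK₃ := norm_fderiv_apply_self_le hζ hK₁
  have hζ2 : ContDiff ℝ 2 ζ := hζ.contDiff.of_le (by norm_cast)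
  have hK₁0 : 0 ≤ K₁ := (norm_nonneg _).trans (hK₁ 0)
  haveI : IsFiniteMeasure ((volume : Measure (EuclideanSpace ℝ (Fin 3))).restrict (ball x₀ R)) :=
    ⟨by rw [Measure.restrict_apply_univ]; exact measure_ball_lt_top⟩
  haveI : IsFiniteMeasure (volume.restrict (Ioo a b ×ˢ ball x₀ R)) :=
    NSCylinder.isFiniteMeasure_restrict (Ω := ⟨ball x₀ R, isOpen_ball⟩) isBounded_ball a b
  -- the pressure on the cylinder
  set Cp : ℝ≥0∞ := volume (Ioo a b ×ˢ ball x₀ R) ^ (1 / 10 : ℝ) *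
    (2 * (⌈(b - a) / T⌉₊ + 1 : ℕ) * (C : ℝ≥0∞)) ^ (9 / 10 : ℝ) with hCp
  have hCptop : Cp ≠ ⊤ := cylinderPressureBound_ne_top T C a b x₀ R
  have hP : ∫⁻ z in Ioo a b ×ˢ ball x₀ R, ‖p z.1 z.2‖ₑ ^ (3 / 2 : ℝ) ≤ Cp :=
    h.lintegral_cylinder_pressure_le hT a b x₀ R
  have hpm : AEStronglyMeasurable (uncurry p) (volume.restrict (Ioo a b ×ˢ ball x₀ R)) :=
    h.aestronglyMeasurable_pressure.restrict
  have hpi := h.integrable_cylinder_pressure hT a b x₀ R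
  -- the primitive representation and the remainder bound
  obtain ⟨c, hc⟩ := h.exists_ae_pairing_eq_const_add_primitive (a := a) (b := b) hT hW hη hε hζ
  have hR := h.ae_abs_remainder_le hT hW.continuous hη hε hM0 hM hζ2 hK₀ hK₁ hK₂ hK₃
  -- abbreviations
  set A : ℝ := (K₂ + 2 * K₀ + K₁ * (‖x₀‖ + |R|) + K₁ * M) *
      ((volume (ball x₀ R)).toReal + (C : ℝ) + M * (volume (ball x₀ R)).toReal) +
    K₁ * (M * ((volume (ball x₀ R)).toReal + (C : ℝ)) +
      ((C : ℝ) + (∫⁻ y, ‖η y‖ₑ).toReal ^ 2 * (C : ℝ))) with hA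
  set B : ℝ := (((volume (ball x₀ R)) ^ (1 / 2 : ℝ) * Cp) ^ (2 / 3 : ℝ)).toReal with hB
  have hB0 : 0 ≤ B := ENNReal.toReal_nonneg
  set F : ℝ → ℝ := fun s => ∫ x in ball x₀ R, (⟪U s x + W s x, Δ ζ x⟫ -
      ⟪U s x + W s x, (2 : ℝ) • ζ x + fderiv ℝ ζ x x⟫ +
      ⟪U s x, fderiv ℝ ζ x (W s x + mollify η ε U s x)⟫ +
      ⟪W s x, fderiv ℝ ζ x (U s x + W s x)⟫ +
      p s x * VectorCalculus.divergence ζ x) with hF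
  -- integrability in time of the remainder and of the pressure slice
  obtain ⟨-, hu, -⟩ := h.integrable_cylinder_velocity_add hW.continuous hM
  obtain ⟨hUmem, hWm, hWbd, hmmem⟩ := h.cylinder_classes hW.continuous hη hε hM
  have iG := (integrable_remainder_and_abs_integral_le measurable_snd hUmem hWm hM0 hWbd hmmem
    hpi hζ2 hK₀ hK₁ hK₂ hK₃).1
  have hpi' := hpi
  rw [FunctionSpaces.AubinLions.volume_restrict_prod] at iG hpi'
  have hFi : IntegrableOn F (Ioo a b) volume := iG.integral_prod_left
  have hqi : IntegrableOn (fun τ => ∫ x in ball x₀ R, |p τ x|) (Ioo a b) volume := by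
    have h1 := hpi'.integral_norm_prod_left
    simp only [Real.norm_eq_abs, Function.uncurry_apply_pair] at h1
    exact h1
  -- slice integrability of `U` (to split the pairing of `u = U + W`)
  have hslice : ∀ᵐ t ∂(volume.restrict (Ioo a b)), Integrable (U t) (volume.restrict (ball x₀ R)) :=
    ae_restrict_of_ae (h.ae_memLp_two_slice.mono fun t ht => (ht.1.restrict _).integrable one_le_two)
  have hWint : ∀ r, IntegrableOn (fun y => ⟪W r y, ζ y⟫) (ball x₀ R) volume := fun r =>
    ((((hW.continuous.comp (continuous_const.prodMk continuous_id) : Continuous (W r)).inner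
      hζ.contDiff.continuous).continuousOn).integrableOn_compact (μ := (volume : Measure (EuclideanSpace ℝ (Fin 3))))
      (isCompact_closedBall x₀ R)).mono_set ball_subset_closedBall
  -- the good set
  refine ⟨{t | t ∈ Ioo a b ∧ (∫ x in ball x₀ R, ⟪U t x + W t x, ζ x⟫) = c + ∫ s in Ioc a t, F s ∧
      Integrable (U t) (volume.restrict (ball x₀ R))}, ?_, ?_⟩
  · filter_upwards [ae_restrict_mem measurableSet_Ioo, hc, hslice] with t ht htc hts
    exact ⟨ht, htc, hts⟩
  -- the increment bound of the primitive, for `s ≤ t`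
  have key : ∀ t ∈ Ioo a b, ∀ s ∈ Ioo a b, s ≤ t →
      |(∫ τ in Ioc a t, F τ) - ∫ τ in Ioc a s, F τ| ≤ A * (t - s) + 3 * K₁ * B * (t - s) ^ (1 / 3 : ℝ) := by
    intro t ht s hs hst
    have hsub_st : Ioc s t ⊆ Ioo a b := fun x hx => ⟨hs.1.trans hx.1, hx.2.trans_lt ht.2⟩
    have hunion : Ioc a t = Ioc a s ∪ Ioc s t := (Ioc_union_Ioc_eq_Ioc hs.1.le hst).symm
    have hdisj : Disjoint (Ioc a s) (Ioc s t) := Ioc_disjoint_Ioc_of_le le_rfl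
    rw [hunion, setIntegral_union hdisj measurableSet_Ioc
      (hFi.mono_set (fun x hx => ⟨hx.1, hx.2.trans_lt hs.2⟩)) (hFi.mono_set hsub_st)]
    simp only [add_sub_cancel_left]
    calc |∫ τ in Ioc s t, F τ| ≤ ∫ τ in Ioc s t, |F τ| := by
          simpa only [← Real.norm_eq_abs] using MeasureTheory.norm_integral_le_integral_norm _
      _ ≤ ∫ τ in Ioc s t, (A + 3 * K₁ * ∫ x in ball x₀ R, |p τ x|) := by
          refine integral_mono_ae (hFi.mono_set hsub_st).abs
            ((integrable_const A).add ((hqi.mono_set hsub_st).const_mul _)) ?_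
          exact ae_restrict_of_ae_restrict_of_subset hsub_st hR
      _ = A * (t - s) + 3 * K₁ * ∫ τ in Ioc s t, ∫ x in ball x₀ R, |p τ x| := by
          rw [integral_add (integrable_const A) ((hqi.mono_set hsub_st).const_mul _),
            MeasureTheory.integral_const, measureReal_restrict_apply_univ,
            Real.volume_real_Ioc_of_le hst, smul_eq_mul, MeasureTheory.integral_const_mul,
            mul_comm (t - s) A]
      _ ≤ A * (t - s) + 3 * K₁ * ((t - s) ^ (1 / 3 : ℝ) * B) :=
          add_le_add le_rfl (mul_le_mul_of_nonneg_left
            (NSCylinder.setIntegral_pressureSlice_le (Ω := ⟨ball x₀ R, isOpen_ball⟩)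
              isBounded_ball hpm hpi hCptop hP hs.1 hst ht.2)
            (mul_nonneg (by norm_num) hK₁0))
      _ = A * (t - s) + 3 * K₁ * B * (t - s) ^ (1 / 3 : ℝ) := by ring
  -- symmetric form of the increment bound for the pairing of `u`
  have key' : ∀ t ∈ Ioo a b, ∀ s ∈ Ioo a b,
      (∫ x in ball x₀ R, ⟪U t x + W t x, ζ x⟫) = c + ∫ τ in Ioc a t, F τ →
      (∫ x in ball x₀ R, ⟪U s x + W s x, ζ x⟫) = c + ∫ τ in Ioc a s, F τ →
      |(∫ x in ball x₀ R, ⟪U t x + W t x, ζ x⟫) - ∫ x in ball x₀ R, ⟪U s x + W s x, ζ x⟫| ≤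
        A * |t - s| + 3 * K₁ * B * |t - s| ^ (1 / 3 : ℝ) := by
    intro t ht s hs htc hsc
    rw [htc, hsc, add_sub_add_left_eq_sub]
    rcases le_total s t with hst | hts
    · have e : |t - s| = t - s := abs_of_nonneg (sub_nonneg.2 hst)
      rw [e]
      exact key t ht s hs hst
    · have e : |t - s| = s - t := by rw [abs_sub_comm]; exact abs_of_nonneg (sub_nonneg.2 hts)
      rw [e, abs_sub_comm]
      exact key s hs t ht hts
  -- assemble: pairing of `U` = pairing of `u` − pairing of `W`
  rintro t ⟨ht, htc, hti⟩ s ⟨hs, hsc, hsi⟩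
  have hsplit : ∀ r, Integrable (U r) (volume.restrict (ball x₀ R)) →
      (∫ x in ball x₀ R, ⟪U r x, ζ x⟫) =
        (∫ x in ball x₀ R, ⟪U r x + W r x, ζ x⟫) - ∫ x in ball x₀ R, ⟪W r x, ζ x⟫ := by
    intro r hr
    have hiU : Integrable (fun x => ⟪U r x, ζ x⟫) (volume.restrict (ball x₀ R)) := by
      refine (hr.norm.mul_const K₀).mono' (hr.1.inner hζ.contDiff.continuous.aestronglyMeasurable)
        (Eventually.of_forall fun x => ?_)
      exact (norm_inner_le_norm _ _).trans (mul_le_mul_of_nonneg_left (hK₀ x) (norm_nonneg _))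
    have hiUW : Integrable (fun x => ⟪U r x + W r x, ζ x⟫) (volume.restrict (ball x₀ R)) :=
      (hiU.add (hWint r)).congr (Eventually.of_forall fun x => (inner_add_left _ _ _).symm)
    rw [← integral_sub hiUW (hWint r)]
    refine integral_congr_ae (Eventually.of_forall fun x => ?_)
    show ⟪U r x, ζ x⟫ = ⟪U r x + W r x, ζ x⟫ - ⟪W r x, ζ x⟫
    rw [inner_add_left]
    ring
  have hWlip := abs_setIntegral_inner_profile_sub_le hW hM' hζ.contDiff.continuous hK₀
    (Ioo_subset_Icc_self hs) (Ioo_subset_Icc_self ht)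
  have hu_incr := key' t ht s hs htc hsc
  rw [hsplit t hti, hsplit s hsi]
  have e : (∫ x in ball x₀ R, ⟪U t x + W t x, ζ x⟫) - (∫ x in ball x₀ R, ⟪W t x, ζ x⟫) -
      ((∫ x in ball x₀ R, ⟪U s x + W s x, ζ x⟫) - ∫ x in ball x₀ R, ⟪W s x, ζ x⟫) =
      ((∫ x in ball x₀ R, ⟪U t x + W t x, ζ x⟫) - ∫ x in ball x₀ R, ⟪U s x + W s x, ζ x⟫) -
        ((∫ x in ball x₀ R, ⟪W t x, ζ x⟫) - ∫ x in ball x₀ R, ⟪W s x, ζ x⟫) := by ring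
  rw [e]
  refine (abs_sub _ _).trans ?_
  calc |(∫ x in ball x₀ R, ⟪U t x + W t x, ζ x⟫) - ∫ x in ball x₀ R, ⟪U s x + W s x, ζ x⟫| +
        |(∫ x in ball x₀ R, ⟪W t x, ζ x⟫) - ∫ x in ball x₀ R, ⟪W s x, ζ x⟫|
      ≤ (A * |t - s| + 3 * K₁ * B * |t - s| ^ (1 / 3 : ℝ)) +
          M * K₀ * (volume (ball x₀ R)).toReal * |t - s| := add_le_add hu_incr hWlip
    _ = (A + M * K₀ * (volume (ball x₀ R)).toReal) * |t - s| +
          3 * K₁ * B * |t - s| ^ (1 / 3 : ℝ) := by ring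

end Modulus

/-! ### The compactness theorem on a cylinder -/

section Compactness

variable {T : ℝ} {W : ℝ → (EuclideanSpace ℝ (Fin 3)) → (EuclideanSpace ℝ (Fin 3))} {η : (EuclideanSpace ℝ (Fin 3)) → ℝ} {C : ℝ≥0}

/-- **Weak gradients of periodic fields over bounded time windows**: if `G` is a weak spatial
gradient on `ℝ × ℝ³` of a `T`-periodic field with `∫∫_{(0,T)×ℝ³} |G|² ≤ C`, then
`∫∫_{(a,b)×ℝ³} |G|² ≤ 2(⌈(b−a)/T⌉₊ + 1) C` (`G` is a.e. periodic, being a.e. unique). [folklore] -/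
theorem lintegral_window_gradient_le {U : ℝ → (EuclideanSpace ℝ (Fin 3)) → (EuclideanSpace ℝ (Fin 3))} {G : ℝ → (EuclideanSpace ℝ (Fin 3)) → (EuclideanSpace ℝ (Fin 3)) →L[ℝ] (EuclideanSpace ℝ (Fin 3))}
    (hG : HasWeakSpatialGradientOn (⊤ : Opens (ℝ × (EuclideanSpace ℝ (Fin 3)))) U G) (hT : 0 < T)
    (hper : ∀ s y, U (s + T) y = U s y)
    (hGb : ∫⁻ z in Ioo 0 T ×ˢ (univ : Set (EuclideanSpace ℝ (Fin 3))), ENNReal.ofReal (frobeniusNormSq (G z.1 z.2)) ≤ C)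
    (a b : ℝ) :
    ∫⁻ z in Ioo a b ×ˢ (univ : Set (EuclideanSpace ℝ (Fin 3))), ENNReal.ofReal (frobeniusNormSq (G z.1 z.2)) ≤
      2 * (⌈(b - a) / T⌉₊ + 1 : ℕ) * C := by
  have hae := hG.ae_forall_comp_add_int_mul hper
  refine (setLIntegral_Ioo_prod_le_of_ae_periodic
    (f := fun z : ℝ × (EuclideanSpace ℝ (Fin 3)) => ENNReal.ofReal (frobeniusNormSq (G z.1 z.2))) hT (fun k => ?_) a b).trans
    (mul_le_mul' le_rfl hGb)
  filter_upwards [hae] with z hz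
  simp only [hz k]

/-- **Strong `L²` compactness of the perturbations on a cylinder** ([BT1], proof of Thm 2.4:
"there exists … `U` … and a sequence … so that … `U_{ε_k} → U` strongly in `L²(0,T;L²(K))` for
all compact sets `K ⊂ ℝ³`"; Temam 1977/79, Ch. III, Thm. 2.1; Lemarié-Rieusset 2016, Thm. 12.1).
Let `(U_k, p_k)` be `T`-periodic weak solutions of the mollified perturbed Leray systems at scales
`ε_k > 0` around a `C¹` profile `W`, with a kernel `η ∈ C_c^∞`, `∫η = 1`, and a common bound `C`
(`IsMollifiedPeriodicWeakSolution T W η ε_k C U_k p_k`). Then on every cylinder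
`(a, b) × B(x₀, R)` a subsequence `U_{σ i}` converges **strongly in `L²`** (and slice-wise in
`𝓓'(B(x₀,R))` for a.e. `t`) to a jointly measurable `u` with `∫_{B(x₀,R)} ‖u(t)‖² ≤ C` for a.e.
`t`: the momentum equation gives the equicontinuity of the pairings up to null sets
(`exists_fullMeasure_pairing_modulus`, with constants uniform in `k`), and the generic
Aubin–Lions theorem `AubinLions.exists_subseq_strong_limit_of_equicontinuous` does the rest. [cite: BradshawTsai2017AHP, proof of Thm 2.4 (limit ε → 0)] -/
theorem exists_subseq_strong_limit_velocity (hT : 0 < T) (hW : ContDiff ℝ 1 (uncurry W))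
    (hη : IsMollifyingKernel η) {ε : ℕ → ℝ} (hε : ∀ k, 0 < ε k)
    {U : ℕ → ℝ → (EuclideanSpace ℝ (Fin 3)) → (EuclideanSpace ℝ (Fin 3))} {p : ℕ → ℝ → (EuclideanSpace ℝ (Fin 3)) → ℝ}
    (hsol : ∀ k, IsMollifiedPeriodicWeakSolution T W η (ε k) C (U k) (p k))
    (a b : ℝ) (x₀ : (EuclideanSpace ℝ (Fin 3))) (R : ℝ) :
    ∃ (σ : ℕ → ℕ) (u : ℝ → (EuclideanSpace ℝ (Fin 3)) → (EuclideanSpace ℝ (Fin 3))), StrictMono σ ∧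
      AEStronglyMeasurable (uncurry u) (volume.restrict (Ioo a b ×ˢ ball x₀ R)) ∧
      (∀ᵐ t ∂(volume.restrict (Ioo a b)), ∫⁻ x in ball x₀ R, ‖u t x‖ₑ ^ 2 ≤ C) ∧
      Tendsto (fun i => ∫⁻ z in Ioo a b ×ˢ ball x₀ R, ‖U (σ i) z.1 z.2 - u z.1 z.2‖ₑ ^ 2)
        atTop (𝓝 0) ∧
      ∀ φ : (EuclideanSpace ℝ (Fin 3)) → ℝ, FunctionSpaces.IsTestFunctionOn (⟨ball x₀ R, isOpen_ball⟩ : Opens (EuclideanSpace ℝ (Fin 3))) φ →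
        ∀ᵐ t ∂(volume.restrict (Ioo a b)),
          Tendsto (fun i => ∫ x in ball x₀ R, φ x • U (σ i) t x) atTop
            (𝓝 (∫ x in ball x₀ R, φ x • u t x)) := by
  set Ω : Opens (EuclideanSpace ℝ (Fin 3)) := ⟨ball x₀ R, isOpen_ball⟩ with hΩ
  haveI : IsFiniteMeasure ((volume : Measure (EuclideanSpace ℝ (Fin 3))).restrict (ball x₀ R)) :=
    ⟨by rw [Measure.restrict_apply_univ]; exact measure_ball_lt_top⟩
  have hCtop : ((C : ℝ≥0) : ℝ≥0∞) ≠ ⊤ := ENNReal.coe_ne_top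
  -- the uniform bounds of the profile on the compact cylinder
  obtain ⟨M, hM0, hM, hM'⟩ := exists_profile_bound hW a b x₀ R
  -- measurability, energies, gradients
  have hvm : ∀ k, AEStronglyMeasurable (uncurry (U k)) (volume.restrict (Ioo a b ×ˢ ball x₀ R)) :=
    fun k => (hsol k).aestronglyMeasurable_velocity.restrict
  have hE : ∀ k, ∀ᵐ t ∂(volume.restrict (Ioo a b)), ∫⁻ x in ball x₀ R, ‖U k t x‖ₑ ^ 2 ≤ C :=
    fun k => (hsol k).ae_lintegral_ball_sq_le a b x₀ R
  choose G hG using fun k => (hsol k).weakForm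
  have hGw : ∀ k, HasWeakSpatialGradientOn (⊤ : Opens (ℝ × (EuclideanSpace ℝ (Fin 3)))) (U k) (G k) := fun k => (hG k).1
  set Cg : ℝ≥0∞ := 2 * (⌈(b - a) / T⌉₊ + 1 : ℕ) * (C : ℝ≥0∞) with hCg
  have hCgtop : Cg ≠ ⊤ :=
    ENNReal.mul_ne_top (ENNReal.mul_ne_top ENNReal.ofNat_ne_top (ENNReal.natCast_ne_top _)) hCtop
  have hGcyl : ∀ k, HasWeakSpatialGradientOn (timeCylinder Ω a b) (U k) (G k) :=
    fun k => (hGw k).mono le_top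
  have hGm : ∀ k, AEStronglyMeasurable (uncurry (G k)) (volume.restrict (Ioo a b ×ˢ ball x₀ R)) :=
    fun k => (hGcyl k).locallyIntegrableOn_grad.aestronglyMeasurable
  have hGs : ∀ k, ∀ᵐ t ∂(volume.restrict (Ioo a b)),
      FunctionSpaces.HasWeakFDerivOn Ω volume (U k t) (G k t) :=
    fun k => (hGcyl k).ae_hasWeakFDerivOn_slice
  have hGb : ∀ k, ∫⁻ z in Ioo a b ×ˢ ball x₀ R, ‖G k z.1 z.2‖ₑ ^ 2 ≤ Cg := fun k => by
    refine NSCylinder.lintegral_enorm_sq_le_of_frobenius ?_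
    exact (lintegral_mono_set (prod_mono Subset.rfl (subset_univ _))).trans
      (lintegral_window_gradient_le (hGw k) hT (hsol k).periodic (hG k).2.1 a b)
  -- equicontinuity of the pairings
  have hEC : ∀ φ : (EuclideanSpace ℝ (Fin 3)) → ℝ, FunctionSpaces.IsTestFunctionOn Ω φ →
      ∃ ω : ℝ → ℝ, Tendsto ω (𝓝 0) (𝓝 0) ∧
        ∀ k, ∃ S : Set ℝ, (∀ᵐ t ∂(volume.restrict (Ioo a b)), t ∈ S) ∧
          ∀ t ∈ S, ∀ s ∈ S, ‖(∫ x in (Ω : Set (EuclideanSpace ℝ (Fin 3))), φ x • U k t x) -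
            ∫ x in (Ω : Set (EuclideanSpace ℝ (Fin 3))), φ x • U k s x‖ ≤ ω (t - s) := by
    intro φ hφ
    have hζ : ∀ i, FunctionSpaces.IsTestFunctionOn Ω
        (fun x => φ x • EuclideanSpace.basisFun (Fin 3) ℝ i) := fun i =>
      NSCylinder.isTestFunctionOn_smul_const hφ _
    choose K₀ K₁ K₂ hK₀ hK₁ hK₂ using fun i => exists_bounds_of_isTestFunctionOn (hζ i)
    -- the constants of the modulus, for each coordinate
    set V : ℝ := (volume (ball x₀ R)).toReal with hV
    set A : Fin 3 → ℝ := fun i =>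
      (K₂ i + 2 * K₀ i + K₁ i * (‖x₀‖ + |R|) + K₁ i * M) * (V + (C : ℝ) + M * V) +
        K₁ i * (M * (V + (C : ℝ)) + ((C : ℝ) + (∫⁻ y, ‖η y‖ₑ).toReal ^ 2 * (C : ℝ))) +
        M * K₀ i * V with hA
    set B : Fin 3 → ℝ := fun i => 3 * K₁ i * (((volume (ball x₀ R)) ^ (1 / 2 : ℝ) *
      (volume (Ioo a b ×ˢ ball x₀ R) ^ (1 / 10 : ℝ) *
        (2 * (⌈(b - a) / T⌉₊ + 1 : ℕ) * (C : ℝ≥0∞)) ^ (9 / 10 : ℝ))) ^ (2 / 3 : ℝ)).toReal with hB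
    refine ⟨fun δ => ∑ i, (A i * |δ| + B i * |δ| ^ (1 / 3 : ℝ)), ?_, fun k => ?_⟩
    · have hc : Continuous fun δ : ℝ => ∑ i, (A i * |δ| + B i * |δ| ^ (1 / 3 : ℝ)) :=
        continuous_finsetSum _ fun i _ => (continuous_const.mul continuous_abs).add
          (continuous_const.mul (continuous_abs.rpow_const fun _ => Or.inr (by norm_num)))
      have h0 := hc.tendsto 0
      simpa [Real.zero_rpow (by norm_num : (1 / 3 : ℝ) ≠ 0)] using h0
    -- the good set for the `k`-th solution
    choose S hSae hS using fun i => (hsol k).exists_fullMeasure_pairing_modulus hT hW hη (hε k)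
      hM0 hM hM' (hζ i) (hK₀ i) (hK₁ i) (hK₂ i)
    have hslice : ∀ᵐ t ∂(volume.restrict (Ioo a b)),
        MemLp (U k t) 2 (volume.restrict (ball x₀ R)) :=
      ae_restrict_of_ae ((hsol k).ae_memLp_two_slice.mono fun t ht => ht.1.restrict _)
    refine ⟨{t | (∀ i, t ∈ S i) ∧ MemLp (U k t) 2 (volume.restrict (ball x₀ R))}, ?_, ?_⟩
    · have hall : ∀ᵐ t ∂(volume.restrict (Ioo a b)), ∀ i, t ∈ S i := ae_all_iff.2 hSae
      filter_upwards [hall, hslice] with t h1 h2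
      exact ⟨h1, h2⟩
    rintro t ⟨htS, htm⟩ s ⟨hsS, hsm⟩
    have hit : Integrable (fun x => φ x • U k t x) (volume.restrict (ball x₀ R)) :=
      FunctionSpaces.Ehrling.integrable_smul_of_memLp_two hφ htm
    have his : Integrable (fun x => φ x • U k s x) (volume.restrict (ball x₀ R)) :=
      FunctionSpaces.Ehrling.integrable_smul_of_memLp_two hφ hsm
    calc ‖(∫ x in (Ω : Set (EuclideanSpace ℝ (Fin 3))), φ x • U k t x) - ∫ x in (Ω : Set (EuclideanSpace ℝ (Fin 3))), φ x • U k s x‖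
        ≤ ∑ i, |⟪(∫ x in (Ω : Set (EuclideanSpace ℝ (Fin 3))), φ x • U k t x) - ∫ x in (Ω : Set (EuclideanSpace ℝ (Fin 3))), φ x • U k s x,
            EuclideanSpace.basisFun (Fin 3) ℝ i⟫| := norm_le_sum_abs_inner_basisFun _
      _ = ∑ i, |(∫ x in ball x₀ R, ⟪U k t x, φ x • EuclideanSpace.basisFun (Fin 3) ℝ i⟫) -
            ∫ x in ball x₀ R, ⟪U k s x, φ x • EuclideanSpace.basisFun (Fin 3) ℝ i⟫| := by
          refine Finset.sum_congr rfl fun i _ => ?_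
          rw [inner_sub_left, NSCylinder.inner_integral_smul_eq (Ω := Ω) hit,
            NSCylinder.inner_integral_smul_eq (Ω := Ω) his]
          rfl
      _ ≤ ∑ i, (A i * |t - s| + B i * |t - s| ^ (1 / 3 : ℝ)) := by
          refine Finset.sum_le_sum fun i _ => ?_
          have h := hS i t (htS i) s (hsS i)
          rw [hA, hB]
          linarith [h]
  -- the abstract compactness theorem
  obtain ⟨σ, u, hσ, hum, huE, hus, huP⟩ :=
    FunctionSpaces.AubinLions.exists_subseq_strong_limit_of_equicontinuous (F := (EuclideanSpace ℝ (Fin 3)))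
      (FunctionSpaces.isLipschitzDomain_ball x₀ R) isBounded_ball hCtop hCgtop hvm hE hGm hGs hGb hEC
  exact ⟨σ, u, hσ, hum, huE, hus, huP⟩

end Compactness

end BradshawTsai2017

end Literature.Analysis.FluidPDE

end
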